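import Literature.MathematicalPhysics.QuantumFieldTheory.BalabanImbrieJaffe1984to88.BIJ88Decay241RegularTorusCwt
import Literature.MathematicalPhysics.QuantumFieldTheory.BalabanImbrieJaffe1984to88.BIJ88NeumannPropagatorSmallFieldClose
import Literature.MathematicalPhysics.QuantumFieldTheory.BalabanImbrieJaffe1984to88.BIJ88NeumannPropagatorSmallFieldSupDecay
import Literature.MathematicalPhysics.QuantumFieldTheory.BalabanImbrieJaffe1984to88.BIJ85ScalarPropagatorSupDecay

/-!
# `BalabanImbrieJaffe1984to88.BIJ88DeltaLocSmallPlaquetteTorusCwt` — T. Bałaban, J. Imbrie, A. Jaffe, *Effective action and cluster properties of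
the abelian Higgs model*, Commun. Math. Phys. **114** (1988) 257–315 [BalabanImbrieJaffe1988], §2 (2.27)–(2.31) / (2.34)–(2.36) p. 263 [PDF 7],
(2.38)–(2.41) p. 264 [PDF 8] and (4.9) p. 275 [PDF 19]; T. Bałaban, J. Imbrie, A. Jaffe, *Renormalization of the Higgs model: minimizers,
propagators and the stability of mean field theory*, Commun. Math. Phys. **97** (1985) 299–329 [BalabanImbrieJaffe1985] = [I], §7.3 p. 326
[PDF 28]: **(2.30), (2.31), (2.35), (2.36), (2.38), (2.40)/(4.9)_{j≥1} AND (2.41) FOR `G_{k,loc}(u)`, `Δ_{k,loc}(u)` AND `C^{(k)}_Λ(u)` WITH `Ω = T_η` AT A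
GENERAL SMALL-PLAQUETTE NON-FLAT `U(1)` BACKGROUND `u` (`‖u(∂p) − 1‖ ≤ θ`, `(L^{2k}θ)² ≤ 1/500` — NO gauge condition, NO regular representative),
FOR THE PRINTED LOCALIZATION DATA OF RECORD** (p29's torus cubes `□_α` (2.27) `cubeFam`, weights `λ_α` `lamFam`, p13's cut-off `ζ″` (2.29)
`cutoff R₁ R₀ T`), HYPOTHESIS-FREE — the eight members of this seat's row-restricted chain (`BIJ88DeltaLocClose235General` §10: `opDecay230_gen`,
`opClose231_gen`, `close231_kernel_gen`, `close235_gen`, `decay236_gen`, `ineq238_gen`, `Z49_gen`, `decay241_gen`) instantiated with `X₀ = T^{(0)}`,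
`X_α` = the `10L^k`-deep rows of `□_α`, and their three inputs ((H1.10) for `G_k(T_η,u)`, (H1.10″) for `G_k(□_α,u)`, (H1.12″) for
`G_k(□_α,u) − G_k(T_η,u)`) SUPPLIED AT ONE SET OF CONSTANTS by p27's torus and cube members of [7] (1.10) under (7.3.1) and p30's (1.11)–(1.12)
member (`inputs_smallPlaquette`, §1).  It is the small-field twin of r18 gen 24's `BIJ88Close231RegularTorusCwt` ((2.30)–(2.36) at
`u = e^{ieεA}`, `A` (2.23)-regular) and of gen 21's `BIJ88Decay241RegularTorusCwt` ((2.38)–(2.41) there).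

statement-level skeleton of published theorems with citation tags; proofs where landed; nothing here is a claim about the Yang–Mills mass gap

PDFs held: `paper:balaban1988-cmp114-bij-abelian-higgs-effective-action` (journal page = PDF page + 256; p. 263 = PDF 7, p. 264 = PDF 8,
p. 275 = PDF 19); `paper:balaban1985-cmp97-bij-higgs-minimizers` (journal page = PDF page + 298; p. 326 = PDF 28, re-read this session:
*«The propagators arising from Δ_k(u_k), under the restriction (7.3.1) on the gauge field, also satisfy the regularity and decay estimates of [7].»*).

CITATION HEADER (lean-in-tree rule).  lit-balaban cell (HOME `run/shared/lean/pub/lit-balaban/`), Phase 2, proof seat **p31 gen 22** (unit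
`lit-balaban-p31`, literature-prover-lit-balaban-p31-g22-0), free-target protocol G.5-34(d), TAKING #2 line HOME/STATUS.md 2026-08-23T05:49:50Z
(window → 06:11Z, no objection; stem check `DeltaLocSmall` / `SmallPlaquetteTorusCwt` = ∅; notices to r18 g25, p30 g27, p27 g36, p29 g30, r15,
p34 g18).  Rows of `HOME/lit-balaban-r18/ROWS-C2.md` served (LOCATED MEMBERS, cells only; heads unchanged; owner r18): **C2.Eq2.30**, **C2.Eq2.31**,
**C2.Eq2.35**, **C2.Eq2.36**, **C2.Eq2.38**, **C2.Eq2.40**, **C2.Eq2.41** (+ the (4.9)_{j≥1} token of C3), and r15's **C1.Eq7.3.1-7.3.2** (the p. 326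
sentence quoted above, located at its (2.30)–(2.41) consequences); r18's C2S14-CLOSURE §5 fronts (α′)[torus + cubes] and (β′) CONSUMED.  Files USED
BY NAME, nothing restated: p31 g20 `BIJ88DeltaLocClose235General` v1.1 (the eight `_gen` members; p346675), p27 g33/g34
`BIJ85ScalarPropagatorSupDecay.decay110_smallField_input` (the (H1.10) member on `T_η` under (7.3.1)) and
`BIJ88NeumannPropagatorSmallFieldSupDecay.decay110_smallPlaquette_cube_uniform` (the (H1.10″) member for no-wrap cubes under (7.3.1)),
p30 g27 `BIJ88NeumannPropagatorSmallFieldClose.close112_smallField_hC` (the (H1.12″) member, p353959), p29 g26–g28 `BIJ88LocWeights227Torus`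
(`cubeFam`, `lamFam`, `labels`, `cubeFam_fits`, `rowHyp_i`, `rowHyp_iii`, `cutoff_eq_zero_of_le`, `cutoff_mem_unitInterval`, `sum_abs_lamT_le_one`,
`mem_and_depth_of_mem_blockK`, `activeLabels`, `card_activeLabels_le`, `card_subtype_activeLabels_le`, `mem_activeLabels_of_ne_zero_of_deep`),
r18 g23/g24 `BIJ88Close231WholeTorusFlatCwt.rowHyp_ii_torus` / `BIJ88Close231RegularTorusCwt` (`deepRows`, `mem_deepRows`), gen 21
`BIJ88Decay241RegularTorusCwt` (`lamFam_symm`, `cutoff_T_symm`), p27 `BIJ88NeumannPropagatorFlatDecayCube` (`cubeT`, `boxCoord`,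
`isBlockUnion_cubeT`), r15/p11 `BIJ85AbelianStokes` (`plaqC`, `plaqC_eq_toC_plaqHol`), p13 `BIJ88Cutoffs21.cutoff`, gen 15 `BIJ88DeltaLoc234Torus`
(`gLocT`, `deltaLocT`, `deltaRegion`), gen 18 `BIJ88Eq240FlatTorus` (`realify`, `compress`, `op240`, `c240`), p03 `BIJ88Normalization46.Z49`,
`BIJ85Ineq732FlatRegion.starB_innerK_univ`, `BIJ88NeumannNoZeroModesTorus` (`IsBlockUnion`, `innerK`, `isBlockUnion_univ`), pv07
`B4Sect5Proof.latticeConst`, p38 `B5Ineq137Torus.T`.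

## The print (verbatim, p. 263 [PDF 7]; p. 264 [PDF 8]; p. 275 [PDF 19]; [I] p. 326 [PDF 28])

p. 263: *"Let {□_α} be the collection of r(e_k)-cubes that can be built from cubes of size M = O(1) as in [6]. Define
G_k(u; x₁, x₂) = Σ_α λ_α G_k(□_α, u; x₁, x₂) (2.27) as a convex combination of Neumann propagators. … We then put
G_{k,loc}(u; x₁, x₂) = ζ_k(x₁, x₂) G_k(u; x₁, x₂), (2.28) … The boundary conditions are always at a distance O(r(e_k)) from x₁, x₂, so a
straightforward application of the random walk expansion of [6] shows that |(G_{k,loc}(u)f)(x)| ≦ c e^{−c dist(suppt f, x)}‖f‖_∞, (2.30)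
|(G_{k,loc}(u)f − G_k(Ω,u)f)(x)| ≦ e^{−cr(e_k)} e^{−c dist(suppt f, x)}‖f‖_∞, (2.31) for dist(x, Ω^c) ≧ O(r(e_k)). … We assume that u is smooth in
the □_α's entering the sum in (2.27); for (2.31) we assume smoothness throughout the subset Ω ⊂ T_η. … We use G_{k,loc} to define a localized
quadratic form for scalar fields, Δ_{k,loc}(u) = a_k I − a_k² Q_k(u) G_{k,loc}(u) Q_k^*(u). (2.34) … Hence |Δ_{k,loc}(u; x₁, x₂) − Δ_k(Ω,u; x₁, x₂)| ≦
e^{−cr(e_k)} e^{−c|x₁−x₂|} for dist({x₁, x₂}, Ω^c) > O(r(e_k)), (2.35) |Δ_{k,loc}(u; x₁, x₂)| ≦ c e^{−|x₁−x₂|}, (2.36)"*.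

p. 264: *"Again we assume u is smooth in the relevant regions; Δ_{k,loc}(u; x₁, x₂) depends on u only in an O(r(e_k))-neighborhood of x₁, x₂.
Finally, in view of (2.35), the lower bound (I.7.3.2) applies to Δ_{k,loc}(u) as well. Let φ be supported in a region having an r(e_k) neighborhood
where u is smooth. Then ⟨φ, Δ_{k,loc}(u)φ⟩ ≧ c₁ Σ_b |u(b)φ(b₊) − φ(b₋)|² − c e_k² p(e_k)² Σ_x |φ(x)|². (2.38) Finally, we need to construct a localized
version of C^{(k)}_Λ(Ω, u) = [(Δ_k(Ω, u) + aL^{−2} Q(u_k)^* Q(u_k))|_Λ]^{−1}, (2.39) the single-scale propagator for the scalar field in the k-th step.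
We have already replaced Δ_k(Ω, u) with Δ_{k,loc}(u). Let us assume u is smooth in a neighborhood of Λ̄, the region for the Dirichlet boundary
conditions in (2.39). We define C^{(k)}_Λ(u) = [(Δ_{k,loc}(u) + aL^{−2} Q(u_k)^* Q(u_k))|_Λ]^{−1}. (2.40) This is of course a nonlocal operator, but by
(2.38), C^{(k)}_Λ(u)^{−1} is bounded below and a random walk expansion as in [6] can be used to prove that |C^{(k)}_Λ(u; x₁, x₂)| ≦ c e^{−c|x₁−x₂|}.
(2.41)"*;  p. 275: *"Z^{(j)}_Λ = ∫ dφ_Λ exp[−½⟨φ, (Δ + κP(u))|_Λ φ⟩ − E|Λ|] (4.9)"* (the Gaussian normalization, `j ≥ 1`).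

[I] p. 326: *"let us assume that for the unit lattice field v, |v(∂p) − 1| ≦ e_k p(e_k), (7.3.1) where p(e_k) = (1 + ln e_k^{−1})^p. … The propagators
arising from Δ_k(u_k), under the restriction (7.3.1) on the gauge field, also satisfy the regularity and decay estimates of [7]."*  Here the
restriction is `‖u(∂p) − 1‖ ≤ θ` at EVERY fine plaquette of `T_η`, with the block-scale threshold `(L^{2k}θ)² ≤ 1/500` under which the three
providers apply for `d′ ≤ 3` (`smallness_of_threshold`).

## What is proved (0 `sorry`; theorems only — no definition, no `Prop`-valued fact)

* §1 `smallness_of_threshold` ((L^{2k}θ)² ≤ 1/500, d′ ≤ 3 ⟹ p27/p30's `2d′³(L^{2k}θ)² ≤ 1` and p27's cube `(T, ½)`-condition with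
  `T = (d′−1)(L^k−1)θ`) and **`inputs_smallPlaquette`**: for `2 ≤ d′ = d + 1 ≤ 3`, `L = ℓ + 1` with `ℓ ≥ 1`, `ℓ + 1` odd, `a > 0`: `∃ δ₀ c₀ > 0` (from
  `(d, ℓ, a)` only) such that on every torus of the series, every `1 ≤ k ≤ K` with `2(L^k − 1) + 4 < |T^{(0)}|`, every `U(1)` field `u` with
  `‖u(∂p) − 1‖ ≤ θ`, `0 ≤ θ`, `(L^{2k}θ)² ≤ 1/500`, every reference no-wrap box `Ω₀ = c·L^k + Π_i[0, L^kM₀_i)` (`M₀_i ≥ 1`, shorter than the torus) and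
  every `(s_g, W)`: (H1.10) for `G_k(T_η,u)` at every row, (H1.10″) for every `G_k(□_α,u)` and (H1.12″) for every `G_k(□_α,u) − G_k(T_η,u)` at the
  `10L^k`-deep rows of `□_α`, all with `(c₀, δ₀)` — p27's `decay110_smallField_input` + `decay110_smallPlaquette_cube_uniform` (through p29's
  `cubeFam_fits`) + p30's `close112_smallField_hC` fed with the first two, constants unified by `max`/`min` and monotonicity.
* §2 `rowHyp_ii_deep`, **`rows_of_deep`**: the five row hypotheses (o)(i)(ii″)(iii) + multiplicity `#S ≤ m = (⌊(L^k − 1 + R₀)/s_g⌋ + 3)^{d+1}` of the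
  `_gen` members for the block of a `k`-site lying in `Ω₀` at chart depth `≥ R₀ + R`, `R > ρ` (here `ρ = 10L^k`), torus gap `≥ R`, half-width
  `W ≥ 2s_g/3 + R₀/2 + R` — p29 §3–§4 and r18's `rowHyp_ii_torus` BY NAME.
* §3 **`opClose231_smallPlaquette_torus_cwt`** ((2.31), operator form: `‖(G_{k,loc}(u)f − G_k(T_η,u)f)(x)‖ ≤ (L^kε)²·c₀·(m·e^{−2δ₀R/L^k} +
  e^{−(δ₀/2)R₁/L^k})·e^{−(δ₀/2)D/L^k}·‖f‖_∞` at every fine row `x ∈ Ω₀` of chart depth `≥ R₀ + R`, `R > 10L^k`, `0 ≤ R₁ < R₀`),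
  **`close231_smallPlaquette_torus_kernel_cwt`** ((2.31), kernel form, every `y`), **`opDecay230_smallPlaquette_cwt`** ((2.30):
  `‖(G_{k,loc}(u)f)(x)‖ ≤ (L^kε)²·m·c₀·e^{−δ₀D/L^k}·‖f‖_∞`).
* §4 **`close235_smallPlaquette_torus_cwt`** ((2.35): `‖Δ_{k,loc}(u; y₁,y₂) − Δ_k(T_η,u; y₁,y₂)‖ ≤ A·a_k·c₀e^{δ₀/2}·(m·e^{−2δ₀R/L^k} +
  e^{−(δ₀/2)R₁/L^k})·e^{−(δ₀/2)|y₁−y₂|}` for `y₁` whose block lies in `Ω₀` at chart depth `≥ R₀ + R`, every `y₂`; `A = α_kL^{kd′}` gen 15's counting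
  normalization), **`decay236_smallPlaquette_cwt`** ((2.36): `‖Δ_{k,loc}(u; y₁,y₂)‖ ≤ A·(δ_{y₁y₂} + m·a_k·c₀e^{δ₀}·e^{−δ₀|y₁−y₂|})`).
* §5 **`ineq238_smallPlaquette_torus_cwt`** ((2.38): `(A/a_k)·[γ₀Σ_b‖u_k(b)φ(b₊) − φ(b₋)‖² − ((4/3)d′⁴(L^{2k}θ)² + a_k²c₀e^{δ₀/2}K_{d′}(δ₀/2)(m·e^{−2δ₀R/L^k}
  + e^{−(δ₀/2)R₁/L^k}))·‖φ‖²] ≤ Re⟨φ, Δ_{k,loc}(u)φ⟩` for every `φ` supported on `k`-sites whose blocks lie in `Ω₀` at chart depth `≥ R₀ + R`;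
  `γ₀ = min(a/(9(d′+1)), 1/12)`, `u_k = lineIter u k`; the (7.3.2) input is gen 20's `ineq238_deltaRegion_smallField_region` at `Ω = T`).
* §6 **`Z49_smallPlaquette_torus_cwt`** ((2.40) + (4.9)_{j≥1}: with `k + 1 ≤ m + K`, every `Λ` of such `k`-sites, every [I] (4.5.4)-type smallness
  `(T₁, δ′, σ)` of `u_k` inside the `L`-blocks of `T^{(k)}`, `κ′ ≥ 0` and the largeness condition `E < c240(γ₀,κ′)(1−σ)`: the realified precision
  `realify((Δ_{k,loc}(u) + (A/a_k)κ′P(u_k))|_Λ)` is positive definite, `Z^{(k)}_Λ = e^{−E_sN}(2π)^{#(Λ×2)/2}/√det`, `Z^{(k)}_Λ > 0`).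
* §7 **`decay241_smallPlaquette_torus_cwt`** ((2.41): under the same data and `0 ≤ ϑ ≤ δ₀/4`, `ϑ·W(…) ≤ (c240(1−σ) − E)/2`:
  `‖C^{(k)}_Λ(u; x₁,x₂)‖ ≤ (a_k/A)·(4/(c240(γ₀,κ′)(1−σ) − E))·e^{−ϑ|x₁−x₂|_{T^{(k)}}}` for all `x₁, x₂ ∈ Λ`).

HONEST SCOPE / DIVERGENCE.  (i) `Ω = T_η` only (print: a general `Ω ⊂ T_η` with *"smoothness throughout the subset Ω"*; the member for a general
`k`-block union `Ω` needs the (H1.10) input for `G_k(Ω,u)` at deep rows — p27 g36's `BIJ88NeumannPropagatorSmallFieldRegionSupDecayDeep` / p34's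
every-row region member — and p30's `close112_smallField_hC` already takes a general `Ω`; not consumed here).  (ii) Print's local smoothness (2.32)
(`u = exp[ie_kη(A + dλ)′]`, `|∂A|, |∂^*A| ≦ O(p(e_k))` near each `□_α`) is read, following [I] p. 326, as the (7.3.1)-type plaquette smallness
`‖u(∂p) − 1‖ ≤ θ` — but on the WHOLE torus and with the explicit block-scale threshold `(L^{2k}θ)² ≤ 1/500` (the providers' `2d′³(L^{2k}θ)² ≤ 1`
and cube condition for `d′ ≤ 3`; print: `θ = e_kp(e_k)` at the unit `e_kη`-lattice scale).  NO gauge condition on `u`, no regular representative.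
(iii) Dimension/side restrictions of the providers: `2 ≤ d′ ≤ 3` (p30: `2 ≤ d′`; p27's cube member: `d′ ≤ 3`), `L = ℓ + 1` odd with `ℓ ≥ 1`
(p27), `k ≤ K`, `2(L^k − 1) + 4 < |T^{(0)}|`, boxes `Ω₀` with `L^kM₀_i < |T^{(0)}|`.  (iv) The cubes are p29's ORIGINAL torus cubes `cubeFam` (2.27)
(`k`-block unions and no-wrap `cubeT` boxes by p29's `cubeFam_fits`); `X_α` = rows of `□_α` at sup-torus depth `≥ 10L^k` (p30's collar), so the
radii satisfy `R > 10L^k` (print: `O(r(e_k))`, `r(e_k) ~ L^k·|log e_k|`; larger radii only improve the brackets).  (v) Constants `δ₀, c₀`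
existential, depending on `(d, ℓ, a)` only — uniform in the volume, `k`, `u`, the box, `(s_g, W)` and the radii; the decay rates are `δ₀`, `δ₀/2`
per `L^k` (print: `c`, unit `e_kη`-lattice).  (vi) (2.38) is p02's two-constant reading with the (2.35) error explicit (HOME/GAPS.md G-C2-06), for `φ`
supported on deep `k`-sites (print: *"φ supported in a region having an r(e_k) neighborhood where u is smooth"* — here `u` is small everywhere and
the support restriction is the localization depth of the `_gen` row restriction).  (vii) The CONDITIONS of (2.40)/(2.41) (`hE`, `hσ`, `hsmall`) are
displayed numeric hypotheses exactly as in the `_gen` members (print's *"by (2.38), C^{(k)}_Λ(u)^{−1} is bounded below"* located); the averaged-field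
smallness `(T₁, δ′, σ)` of `u_k = lineIter u k` is NOT discharged from `θ` here (it is not gauge invariant; the conclusions of §6–§7 are — gen 22's
`BIJ88Decay241RegularTorusCwtOrbit`; at `u = (e^{ieεA})^h` it is that file's §4).  (viii) Value members only (the order-(1+θ) Hölder/derivative
members of (2.30)/(2.31) are p29's `BIJ88LocDerivHolder230SmallPlaquetteTorus` lane).  (ix) `1 ≤ k`, fine level `0`; `k + 1 ≤ m + K` in §6–§7
(the `L`-blocks of `P(u_k)`).  Imports: gen 21 `BIJ88Decay241RegularTorusCwt` (→ r18, p31 g20, p29), p30 `BIJ88NeumannPropagatorSmallFieldClose`,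
p27 `BIJ88NeumannPropagatorSmallFieldSupDecay`, `BIJ85ScalarPropagatorSupDecay`.  Literature + Mathlib only.  Unit `lit-balaban-p31`
(literature-prover-lit-balaban-p31-g22-0), 2026-08-23.  NOT summit progress.
-/

open scoped BigOperators Matrix ComplexConjugate
open Finset Matrix

namespace Literature.MathematicalPhysics.QuantumFieldTheory.BalabanImbrieJaffe1984to88.BIJ88DeltaLocSmallPlaquetteTorusCwt

open Literature.MathematicalPhysics.QuantumFieldTheory.Balaban1983to89
open BIJ88Sect3Statements (U1 toC starB norm_toC)
open BIJ85BlockAveragesTorus BIJ85BlockAveragesTorusK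
open BIJ88NeumannPropagator227Torus (gBox)
open BIJ88DeltaLoc234Torus (gLocT deltaLocT deltaRegion)
open BIJ88NeumannPropagatorFlatDecayCube (cubeT boxCoord)
open BIJ88Cutoffs21 (cutoff cutoff_congr_dist)
open BIJ88LocWeights227Torus
open BIJ88DeltaLocClose235General (opDecay230_gen opClose231_gen close231_kernel_gen close235_gen decay236_gen ineq238_gen Z49_gen
  decay241_gen)
open BIJ88Close231RegularTorusCwt (deepRows mem_deepRows)
open BIJ88Decay241RegularTorusCwt (lamFam_symm cutoff_T_symm)
open BIJ88Close231WholeTorusFlatCwt (rowHyp_ii_torus)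
open BIJ85AbelianStokes (plaqC plaqC_eq_toC_plaqHol)
open BIJ88NeumannNoZeroModesTorus (IsBlockUnion innerK isBlockUnion_univ)
open BIJ85Ineq732FlatRegion (starB_innerK_univ)
open BIJ88Eq240FlatTorus (realify compress op240 c240)
open BIJ88Normalization46 (Z49)
open B4Sect5Proof (latticeConst)
open BIJ88NeumannPropagatorSmallFieldClose (close112_smallField_hC)
open BIJ88NeumannPropagatorSmallFieldSupDecay (decay110_smallPlaquette_cube_uniform)
open BIJ85ScalarPropagatorSupDecay (decay110_smallField_input)
open BIJ88NeumannPropagatorFlatDecayCube (isBlockUnion_cubeT)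

noncomputable section

variable {P : Params}

/-! ## §1 The three [7]-inputs at a small-plaquette `u`, at ONE set of constants, in the `_gen` shapes for the torus data of record -/

section Inputs

variable {d : ℕ}

/-- kernel: `e^{−δ'E} ≤ e^{−δE}` for `δ ≤ δ'`, `E ≥ 0`. [folklore] -/
private theorem exp_le_exp_of_rate {δ δ' E : ℝ} (hδ : δ ≤ δ') (hE : 0 ≤ E) : Real.exp (-(δ' * E)) ≤ Real.exp (-(δ * E)) :=
  Real.exp_le_exp.2 (neg_le_neg (mul_le_mul_of_nonneg_right hδ hE))

/-- kernel: the block-scale plaquette threshold `(L^{2k}θ)² ≤ 1/500` implies the two smallness conditions of the providers for `d′ ≤ 3`: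
`2d′³(L^{2k}θ)² ≤ 1` and, with `T = (d′−1)(L^k−1)θ`, `2(L^k−1)L^k·d′·T² + 2(d′(L^k−1)T)² ≤ ½`. [cite: BalabanImbrieJaffe1985, (7.3.1) p.326] -/
theorem smallness_of_threshold {dr n θ : ℝ} (hd1 : 1 ≤ dr) (hd3 : dr ≤ 3) (hn : 1 ≤ n) (hθ : 0 ≤ θ)
    (hτ : (n ^ 2 * θ) ^ 2 ≤ 1 / 500) :
    2 * dr ^ 3 * (n ^ 2 * θ) ^ 2 ≤ 1 ∧
      2 * ((n - 1) * n) * dr * ((dr - 1) * (n - 1) * θ) ^ 2 + 2 * (dr * (n - 1) * ((dr - 1) * (n - 1) * θ)) ^ 2 ≤ 1 / 2 := by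
  have hd0 : 0 ≤ dr := by linarith
  have hn0 : 0 ≤ n := by linarith
  have hd27 : dr ^ 3 ≤ 27 := by
    have h := pow_le_pow_left₀ hd0 hd3 3
    norm_num at h
    exact h
  have hd81 : dr ^ 4 ≤ 81 := by
    have h := pow_le_pow_left₀ hd0 hd3 4
    norm_num at h
    exact h
  have hτ0 : 0 ≤ (n ^ 2 * θ) ^ 2 := sq_nonneg _
  refine ⟨?_, ?_⟩
  · calc 2 * dr ^ 3 * (n ^ 2 * θ) ^ 2 ≤ 2 * 27 * (1 / 500) :=
          mul_le_mul (mul_le_mul_of_nonneg_left hd27 (by norm_num)) hτ hτ0 (by norm_num)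
      _ ≤ 1 := by norm_num
  · have hn1 : n - 1 ≤ n := by linarith
    have hdr1 : dr - 1 ≤ dr := by linarith
    have hn10 : 0 ≤ n - 1 := by linarith
    have hdr10 : 0 ≤ dr - 1 := by linarith
    calc 2 * ((n - 1) * n) * dr * ((dr - 1) * (n - 1) * θ) ^ 2 + 2 * (dr * (n - 1) * ((dr - 1) * (n - 1) * θ)) ^ 2
        ≤ 2 * (n * n) * dr * (dr * n * θ) ^ 2 + 2 * (dr * n * (dr * n * θ)) ^ 2 := by gcongr
      _ = (2 * dr ^ 3 + 2 * dr ^ 4) * (n ^ 2 * θ) ^ 2 := by ring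
      _ ≤ (2 * 27 + 2 * 81) * (1 / 500) := mul_le_mul (by linarith) hτ hτ0 (by norm_num)
      _ ≤ 1 / 2 := by norm_num

/-- **THE THREE INPUTS OF THE ROW-RESTRICTED CHAIN AT A SMALL-PLAQUETTE BACKGROUND ON THE WHOLE TORUS, AT ONE SET OF CONSTANTS, FOR THE TORUS
CUBES OF RECORD** ([I] p. 326: *"The propagators arising from Δ_k(u_k), under the restriction (7.3.1) on the gauge field, also satisfy the
regularity and decay estimates of [7]"*).  For `2 ≤ d′ = d + 1 ≤ 3`, `L = ℓ + 1` odd, `a > 0`: there are `δ₀, c₀ > 0` (depending on `(d, ℓ, a)`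
only) such that on every torus of the series, at every level `1 ≤ k ≤ K` with `2(L^k − 1) + 4 < |T^{(0)}|`, for every `U(1)` field `u` with
`‖u(∂p) − 1‖ ≤ θ`, `0 ≤ θ`, `(L^{2k}θ)² ≤ 1/500`, every reference no-wrap box `Ω₀ = c·L^k + Π_i[0, L^kM₀_i)` (`M₀_i ≥ 1`, shorter than the torus)
and every spacing/half-width `(s, W)`, with `G_k(X,u) = gBox (α_kL^{kd′}) ε⁻¹ u k X`:  (H1.10) for `X = T^{(0)}` at EVERY row (p27's
`decay110_smallField_input`); (H1.10″) for every torus cube `□_α = cubeFam … α` at its `10L^k`-deep rows (p27's `decay110_smallPlaquette_cube_uniform`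
through p29's `cubeFam_fits`, valid at every row); (H1.12″) for every `□_α ⊆ T^{(0)}` at its `10L^k`-deep rows, depths to `T ∖ □_α` (p30's
`close112_smallField_hC` fed with the first two) — at the common constants `c₀ = max`, `δ₀ = min`.
[cite: BalabanImbrieJaffe1985, p.326 «also satisfy the regularity and decay estimates of [7]»]
[cite: Balaban1983RegularityDecay, Theorem p.573 (1.10), (1.11)–(1.12)] -/
theorem inputs_smallPlaquette (d ℓ : ℕ) (hd1 : 1 ≤ d) (hd3 : d + 1 ≤ 3) (hℓ : 1 ≤ ℓ) (hodd : Odd (ℓ + 1)) {a : ℝ} (ha : 0 < a) :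
    ∃ δ₀ c₀ : ℝ, 0 < δ₀ ∧ 0 < c₀ ∧ ∀ (P : Params) (hPd : P.d = d + 1), P.L = ℓ + 1 →
      ∀ {k : ℕ}, 1 ≤ k → k ≤ P.K → 2 * (P.L ^ k - 1) + 4 < P.sitesPerDir 0 →
      ∀ (U : GaugeField P 0 U1) {θ : ℝ}, 0 ≤ θ → (∀ (y : Balaban1983to89.Site P 0) (μ ν : Fin P.d), ‖plaqC U y μ ν - 1‖ ≤ θ) →
        (((P.L : ℝ) ^ k) ^ 2 * θ) ^ 2 ≤ 1 / 500 →
      ∀ {c M0 : Fin (d + 1) → ℕ}, (∀ i, 1 ≤ M0 i) → (∀ i, c i * P.L ^ k + P.L ^ k * M0 i ≤ P.sitesPerDir 0) →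
        (∀ i, P.L ^ k * M0 i < P.sitesPerDir 0) → ∀ (s W : ℕ),
      (∀ x ∈ (univ : Finset (Balaban1983to89.Site P 0)), ∀ (f : Balaban1983to89.Site P 0 → ℂ) (F Ds : ℝ), (∀ y, ‖f y‖ ≤ F) → 0 ≤ Ds →
          (∀ y, f y ≠ 0 → Ds ≤ B5Ineq137Torus.T P 0 x y) →
          ‖(gBox (B1RG242Torus.α P a k * (P.L : ℝ) ^ (k * P.d)) P.eps⁻¹ U k univ *ᵥ f) x‖ ≤
            P.spacing k ^ 2 * (c₀ * Real.exp (-(δ₀ * (((P.L : ℝ) ^ k)⁻¹ * Ds))) * F)) ∧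
      (∀ (α : ↥(labels (P.L ^ k) M0 s)), ∀ x ∈ deepRows (10 * (P.L : ℝ) ^ k) (cubeFam hPd (P.L ^ k) c M0 s W α),
        ∀ (f : Balaban1983to89.Site P 0 → ℂ) (F Ds : ℝ), (∀ y, ‖f y‖ ≤ F) → 0 ≤ Ds → (∀ y, f y ≠ 0 → Ds ≤ B5Ineq137Torus.T P 0 x y) →
          ‖(gBox (B1RG242Torus.α P a k * (P.L : ℝ) ^ (k * P.d)) P.eps⁻¹ U k (cubeFam hPd (P.L ^ k) c M0 s W α) *ᵥ f) x‖ ≤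
            P.spacing k ^ 2 * (c₀ * Real.exp (-(δ₀ * (((P.L : ℝ) ^ k)⁻¹ * Ds))) * F)) ∧
      (∀ (α : ↥(labels (P.L ^ k) M0 s)), ∀ x ∈ deepRows (10 * (P.L : ℝ) ^ k) (cubeFam hPd (P.L ^ k) c M0 s W α),
        ∀ (f : Balaban1983to89.Site P 0 → ℂ) (F Ds Db Df : ℝ), (∀ y, ‖f y‖ ≤ F) → (∀ y, y ∉ cubeFam hPd (P.L ^ k) c M0 s W α → f y = 0) →
          0 ≤ Ds → (∀ y, f y ≠ 0 → Ds ≤ B5Ineq137Torus.T P 0 x y) → 0 ≤ Db →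
          (∀ w, w ∉ cubeFam hPd (P.L ^ k) c M0 s W α → Db ≤ B5Ineq137Torus.T P 0 x w) → 0 ≤ Df →
          (∀ y, f y ≠ 0 → ∀ w, w ∉ cubeFam hPd (P.L ^ k) c M0 s W α → Df ≤ B5Ineq137Torus.T P 0 y w) →
          ‖(gBox (B1RG242Torus.α P a k * (P.L : ℝ) ^ (k * P.d)) P.eps⁻¹ U k (cubeFam hPd (P.L ^ k) c M0 s W α) *ᵥ f) x -
              (gBox (B1RG242Torus.α P a k * (P.L : ℝ) ^ (k * P.d)) P.eps⁻¹ U k univ *ᵥ f) x‖ ≤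
            P.spacing k ^ 2 * (c₀ * Real.exp (-(δ₀ * (((P.L : ℝ) ^ k)⁻¹ * Ds))) *
              Real.exp (-(δ₀ * (((P.L : ℝ) ^ k)⁻¹ * (Db + Df)))) * F)) := by
  obtain ⟨δa, ca, hδa, hca, HA⟩ := decay110_smallField_input (d + 1) (ℓ + 1) (Nat.succ_pos d) hd3 ⟨hodd, by omega⟩ ha
  obtain ⟨δb, cb, hδb, hcb, HB⟩ := decay110_smallPlaquette_cube_uniform d ℓ hd3 hℓ ha
  have hcab : 0 ≤ max ca cb := hca.le.trans (le_max_left _ _)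
  have hδab : 0 < min δa δb := lt_min hδa hδb
  obtain ⟨c₁, δ₁, hc₁, hδ₁, HC⟩ := close112_smallField_hC (d + 1) (ℓ + 1) (by omega) hd3 ⟨hodd, by omega⟩ ha hcab hδab
  refine ⟨min (min δa δb) δ₁, max (max ca cb) c₁, lt_min hδab hδ₁, lt_max_of_lt_left (lt_max_of_lt_left hca), ?_⟩
  intro P hPd hPL k hk1 hkK hbig U θ hθ0 hθ hτ c M0 hM0 hfit0 hN0 s W
  have hkm : k ≤ P.m + P.K := hkK.trans (Nat.le_add_left _ _)
  have hk0 : 0 + k ≤ P.m + P.K := by omega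
  have hLr : (1 : ℝ) ≤ (P.L : ℝ) ^ k := one_le_pow₀ (B1RG242Torus.one_lt_cast_L P).le
  have hPk : (0 : ℝ) < (P.L : ℝ) ^ k := pow_pos P.cast_L_pos k
  have hdr : (P.d : ℝ) = (d : ℝ) + 1 := by rw [hPd]; push_cast; ring
  have hd1r : (1 : ℝ) ≤ P.d := by rw [hdr]; linarith [(Nat.cast_nonneg d : (0 : ℝ) ≤ d)]
  have hd3r : (P.d : ℝ) ≤ 3 := by rw [hPd]; exact_mod_cast hd3
  obtain ⟨hsm1, hsm2⟩ := smallness_of_threshold hd1r hd3r hLr hθ0 hτ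
  have hsk2 : 0 ≤ P.spacing k ^ 2 := sq_nonneg _
  -- (H1.10) on the whole torus (p27's torus member), at `(ca, δa)`
  have IA : ∀ (x : Balaban1983to89.Site P 0) (f : Balaban1983to89.Site P 0 → ℂ) (F Ds : ℝ), (∀ y, ‖f y‖ ≤ F) →
      (∀ y, f y ≠ 0 → Ds ≤ B5Ineq137Torus.T P 0 x y) →
      ‖(gBox (B1RG242Torus.α P a k * (P.L : ℝ) ^ (k * P.d)) P.eps⁻¹ U k univ *ᵥ f) x‖ ≤
        P.spacing k ^ 2 * (ca * Real.exp (-(δa * (((P.L : ℝ) ^ k)⁻¹ * Ds))) * F) :=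
    fun x f F Ds hF hsupp => HA P hPd hPL k hk1 hkK U θ hθ hsm1 x f F Ds hF hsupp
  -- (H1.10) for every torus cube at every row (p27's cube member under (7.3.1), via p29's `cubeFam_fits`), at `(cb, δb)`
  have hplaq : ∀ p : Balaban1983to89.Plaq P 0, ‖toC (GaugeField.plaqHol U p) - 1‖ ≤ θ := by
    rintro ⟨y, μ, ν, hμν⟩
    rw [← plaqC_eq_toC_plaqHol U y hμν]; exact hθ y μ ν
  have hT : ((P.d - 1 : ℕ) : ℝ) * ((P.L : ℝ) ^ k - 1) * θ ≤ ((P.d : ℝ) - 1) * ((P.L : ℝ) ^ k - 1) * θ := by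
    have e : ((P.d - 1 : ℕ) : ℝ) = (P.d : ℝ) - 1 := by
      rw [Nat.cast_sub P.hd, Nat.cast_one]
    rw [e]
  have IB : ∀ (α : ↥(labels (P.L ^ k) M0 s)) (x : Balaban1983to89.Site P 0) (f : Balaban1983to89.Site P 0 → ℂ) (F Ds : ℝ),
      (∀ y, ‖f y‖ ≤ F) → (∀ y, f y ≠ 0 → Ds ≤ B5Ineq137Torus.T P 0 x y) →
      ‖(gBox (B1RG242Torus.α P a k * (P.L : ℝ) ^ (k * P.d)) P.eps⁻¹ U k (cubeFam hPd (P.L ^ k) c M0 s W α) *ᵥ f) x‖ ≤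
        P.spacing k ^ 2 * (cb * Real.exp (-(δb * (((P.L : ℝ) ^ k)⁻¹ * Ds))) * F) := by
    intro α x f F Ds hF hsupp
    obtain ⟨c', M, hM, hfit', hN', hα⟩ := cubeFam_fits (hPd := hPd) (s := s) (W := W) hM0 hfit0 hN0 α
    rw [hα]
    exact HB P hPd hPL k hk1 hkm hbig U θ hθ0 hplaq _ hT hsm2 c' M hM hfit' hN' x f F Ds hF hsupp
  -- the common constants
  have hδa' : min (min δa δb) δ₁ ≤ δa := (min_le_left _ _).trans (min_le_left _ _)
  have hδb' : min (min δa δb) δ₁ ≤ δb := (min_le_left _ _).trans (min_le_right _ _)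
  have hδ1' : min (min δa δb) δ₁ ≤ δ₁ := min_le_right _ _
  have hca' : ca ≤ max (max ca cb) c₁ := (le_max_left _ _).trans (le_max_left _ _)
  have hcb' : cb ≤ max (max ca cb) c₁ := (le_max_right _ _).trans (le_max_left _ _)
  have hc1' : c₁ ≤ max (max ca cb) c₁ := le_max_right _ _
  have hcab_a : ca ≤ max ca cb := le_max_left _ _
  have hcab_b : cb ≤ max ca cb := le_max_right _ _
  have hδab_a : min δa δb ≤ δa := min_le_left _ _
  have hδab_b : min δa δb ≤ δb := min_le_right _ _
  -- the cubes are unions of `k`-blocks; the deep rows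
  have hcubeBU : ∀ α : ↥(labels (P.L ^ k) M0 s), IsBlockUnion k (cubeFam hPd (P.L ^ k) c M0 s W α) := fun α => by
    obtain ⟨c', M, hM, hfit', -, e⟩ := cubeFam_fits (hPd := hPd) (s := s) (W := W) hM0 hfit0 hN0 α
    rw [e]; exact isBlockUnion_cubeT hPd hkm rfl hfit'
  have hXr : ∀ α : ↥(labels (P.L ^ k) M0 s), ∀ x ∈ deepRows (10 * (P.L : ℝ) ^ k) (cubeFam hPd (P.L ^ k) c M0 s W α),
      x ∈ cubeFam hPd (P.L ^ k) c M0 s W α ∧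
        ∀ w, w ∉ cubeFam hPd (P.L ^ k) c M0 s W α → 10 * (P.L : ℝ) ^ k ≤ B5Ineq137Torus.T P 0 x w := by
    intro α x hx
    have h := mem_deepRows.1 hx
    refine ⟨h x (by rw [B5Ineq137Torus.T_self P 0 x]; positivity), fun w hw => ?_⟩
    by_contra hlt
    exact hw (h w (le_of_lt (lt_of_not_ge hlt)))
  -- the two (H1.10″) members at the intermediate constants `(max ca cb, min δa δb)` fed to p30's (H1.12″) member
  have IB' : ∀ (α : ↥(labels (P.L ^ k) M0 s)), ∀ x ∈ cubeFam hPd (P.L ^ k) c M0 s W α, ∀ (f : Balaban1983to89.Site P 0 → ℂ)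
      (F Ds : ℝ), (∀ y, ‖f y‖ ≤ F) → 0 ≤ Ds → (∀ y, f y ≠ 0 → Ds ≤ B5Ineq137Torus.T P 0 x y) →
      ‖(gBox (B1RG242Torus.α P a k * (P.L : ℝ) ^ (k * P.d)) P.eps⁻¹ U k (cubeFam hPd (P.L ^ k) c M0 s W α) *ᵥ f) x‖ ≤
        P.spacing k ^ 2 * (max ca cb * Real.exp (-(min δa δb * (((P.L : ℝ) ^ k)⁻¹ * Ds))) * F) := by
    intro α x _ f F Ds hF hDs hsupp
    have hF0 : 0 ≤ F := (norm_nonneg _).trans (hF x)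
    refine (IB α x f F Ds hF hsupp).trans (mul_le_mul_of_nonneg_left ?_ hsk2)
    exact mul_le_mul_of_nonneg_right (mul_le_mul hcab_b (exp_le_exp_of_rate hδab_b (mul_nonneg (inv_pos.2 hPk).le hDs))
      (Real.exp_pos _).le (hcb.le.trans hcab_b)) hF0
  have IA' : ∀ (α : ↥(labels (P.L ^ k) M0 s)), ∀ x ∈ cubeFam hPd (P.L ^ k) c M0 s W α, ∀ (f : Balaban1983to89.Site P 0 → ℂ)
      (F Ds : ℝ), (∀ y, ‖f y‖ ≤ F) → 0 ≤ Ds → (∀ y, f y ≠ 0 → Ds ≤ B5Ineq137Torus.T P 0 x y) →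
      ‖(gBox (B1RG242Torus.α P a k * (P.L : ℝ) ^ (k * P.d)) P.eps⁻¹ U k univ *ᵥ f) x‖ ≤
        P.spacing k ^ 2 * (max ca cb * Real.exp (-(min δa δb * (((P.L : ℝ) ^ k)⁻¹ * Ds))) * F) := by
    intro α x _ f F Ds hF hDs hsupp
    have hF0 : 0 ≤ F := (norm_nonneg _).trans (hF x)
    refine (IA x f F Ds hF hsupp).trans (mul_le_mul_of_nonneg_left ?_ hsk2)
    exact mul_le_mul_of_nonneg_right (mul_le_mul hcab_a (exp_le_exp_of_rate hδab_a (mul_nonneg (inv_pos.2 hPk).le hDs))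
      (Real.exp_pos _).le (hca.le.trans hcab_a)) hF0
  refine ⟨?_, ?_, ?_⟩
  · -- (H1.10) on the whole torus, every row
    intro x _ f F Ds hF hDs hsupp
    have hF0 : 0 ≤ F := (norm_nonneg _).trans (hF x)
    refine (IA x f F Ds hF hsupp).trans (mul_le_mul_of_nonneg_left ?_ hsk2)
    exact mul_le_mul_of_nonneg_right (mul_le_mul hca' (exp_le_exp_of_rate hδa' (mul_nonneg (inv_pos.2 hPk).le hDs))
      (Real.exp_pos _).le (hca.le.trans hca')) hF0
  · -- (H1.10″) for the torus cubes at their deep rows (in fact at every row)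
    intro α x _ f F Ds hF hDs hsupp
    have hF0 : 0 ≤ F := (norm_nonneg _).trans (hF x)
    refine (IB α x f F Ds hF hsupp).trans (mul_le_mul_of_nonneg_left ?_ hsk2)
    exact mul_le_mul_of_nonneg_right (mul_le_mul hcb' (exp_le_exp_of_rate hδb' (mul_nonneg (inv_pos.2 hPk).le hDs))
      (Real.exp_pos _).le (hcb.le.trans hcb')) hF0
  · -- (H1.12″) for the torus cubes against the whole torus, at their `10L^k`-deep rows (p30)
    intro α x hx f F Ds Db Df hF hfB hDs hsupp hDb hsDb hDf hsDf
    have hF0 : 0 ≤ F := (norm_nonneg _).trans (hF x)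
    have h := HC P hPd hPL k hk1 hkK U θ hθ hsm1 univ (cubeFam hPd (P.L ^ k) c M0 s W)
      (fun α => deepRows (10 * (P.L : ℝ) ^ k) (cubeFam hPd (P.L ^ k) c M0 s W α)) (isBlockUnion_univ k) hcubeBU
      (fun α => subset_univ _) hXr IB' IA' α x hx f F Ds Db Df hF hfB hDs hsupp hDb hsDb hDf hsDf
    refine h.trans (mul_le_mul_of_nonneg_left ?_ hsk2)
    refine mul_le_mul_of_nonneg_right ?_ hF0
    exact mul_le_mul (mul_le_mul hc1' (exp_le_exp_of_rate hδ1' (mul_nonneg (inv_pos.2 hPk).le hDs)) (Real.exp_pos _).le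
      (hc₁.le.trans hc1')) (exp_le_exp_of_rate hδ1' (mul_nonneg (inv_pos.2 hPk).le (add_nonneg hDb hDf))) (Real.exp_pos _).le
      (mul_nonneg (hc₁.le.trans hc1') (Real.exp_pos _).le)

end Inputs

/-! ## §2 The five row hypotheses of the `_gen` members for a `k`-site whose block lies deep inside the reference box -/

section Rows

variable {d : ℕ}

/-- kernel: a deeper chart margin implies a shallower one. [folklore] -/
private theorem depth_mono (hPd : P.d = d + 1) {n : ℕ} {c M0 : Fin (d + 1) → ℕ} {D D' : ℝ} (hDD : D ≤ D')
    {x : Balaban1983to89.Site P 0}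
    (hdeep : ∀ i, D' ≤ (boxCoord hPd n c x i : ℝ) ∧ (boxCoord hPd n c x i : ℝ) + D' ≤ (n * M0 i : ℕ) - 1) :
    ∀ i, D ≤ (boxCoord hPd n c x i : ℝ) ∧ (boxCoord hPd n c x i : ℝ) + D ≤ (n * M0 i : ℕ) - 1 :=
  fun i => ⟨hDD.trans (hdeep i).1, by linarith [(hdeep i).2]⟩

/-- **Row hypothesis (ii″) for the torus cubes with `ρ`-deep row sets** (p31 v1.1's `_gen` shape, torus-exterior depths): at a fine site `x ∈ Ω₀` of
chart depth `≥ R₀ + R` with `ρ < R`, an active pair `(x, y)` has `x` a `ρ`-deep row of `□_α`, `y ∈ □_α`, and every `w ∉ □_α` at sup-torus distance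
`≥ R` from `x` and from `y` — r18 gen 23's `rowHyp_ii_torus` BY NAME plus r18 gen 24's `deepRows` bookkeeping. [cite: BalabanImbrieJaffe1988, (2.27) p.263] -/
theorem rowHyp_ii_deep (hPd : P.d = d + 1) {n : ℕ} {c M0 : Fin (d + 1) → ℕ} {s W : ℕ} (hn : 1 ≤ n) (hs : 0 < s)
    (hfit : ∀ i, c i * n + n * M0 i ≤ P.sitesPerDir 0) {R R₀ ρ : ℝ} (hR : 0 ≤ R) (hR₀ : 0 ≤ R₀) (hρ : ρ < R)
    (hgap : ∀ i, ((n * M0 i : ℕ) : ℝ) + R ≤ P.sitesPerDir 0) (hW : 2 * (s : ℝ) / 3 + R₀ / 2 + R ≤ W)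
    {ζ'' : Balaban1983to89.Site P 0 → Balaban1983to89.Site P 0 → ℝ} (hζ : ∀ x y, R₀ ≤ B5Ineq137Torus.T P 0 x y → ζ'' x y = 0)
    {x : Balaban1983to89.Site P 0} (hx : x ∈ (cubeT hPd n c fun i => n * M0 i))
    (hdeep : ∀ i, R₀ + R ≤ (boxCoord hPd n c x i : ℝ) ∧ (boxCoord hPd n c x i : ℝ) + (R₀ + R) ≤ (n * M0 i : ℕ) - 1) :
    ∀ (α : ↥(labels n M0 s)) (y : Balaban1983to89.Site P 0), ζ'' x y * lamFam hPd n c M0 s α x y ≠ 0 →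
      x ∈ deepRows ρ (cubeFam hPd n c M0 s W α) ∧ y ∈ cubeFam hPd n c M0 s W α ∧
        ∀ w, w ∉ cubeFam hPd n c M0 s W α → R ≤ B5Ineq137Torus.T P 0 x w ∧ R ≤ B5Ineq137Torus.T P 0 y w := by
  intro α y hne
  obtain ⟨-, hyα, hfar⟩ := rowHyp_ii_torus hPd hn hs hfit hR hR₀ hgap hW hζ hx hdeep α y hne
  refine ⟨mem_deepRows.2 fun z hz => ?_, hyα, hfar⟩
  by_contra hzα
  have h := (hfar z hzα).1
  linarith

/-- **THE ROW HYPOTHESES OF p31's `_gen` MEMBERS FOR A DEEP `k`-SITE, TORUS CUBES** (print's *"for dist({x₁,x₂},Ω^c) > O(r(e_k))"*, located): if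
the block of `y₁ ∈ T^{(k)}` lies in `Ω₀ = c·L^k + Π_i[0, L^kM₀_i)` with chart margin `R₀ + R` (`R > ρ`, `0 ≤ R₁ < R₀`, torus gap `≥ R`, half-width
`W ≥ 2s_g/3 + R₀/2 + R`), then on every fine row `x` of the block: (o) `x ∈ T^{(0)}`; (i) `ζ″(x,y) ≠ 0 ⇒ Σ_α λ_α(x,y) = 1`; (ii″) an active pair has
`x` a `ρ`-deep row of `□_α`, `y ∈ □_α`, and every `w ∉ □_α` at sup-torus distance `≥ R` from both; (iii) `|x−y|_T ≤ R₁ ⇒ ζ″(x,y) = 1`; and the labels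
active on the block number `≤ (⌊(L^k − 1 + R₀)/s_g⌋ + 3)^{d+1}` — p29's `rowHyp_i`/`rowHyp_iii`/`card_activeLabels_le`/
`mem_activeLabels_of_ne_zero_of_deep` and `rowHyp_ii_deep`. [cite: BalabanImbrieJaffe1988, (2.35) p.263] -/
theorem rows_of_deep (hPd : P.d = d + 1) {k sg W : ℕ} {c M0 : Fin (d + 1) → ℕ} (hk : 0 + k ≤ P.m + P.K) (hn : 1 ≤ P.L ^ k)
    (hsg : 0 < sg) (hfit0 : ∀ i, c i * P.L ^ k + P.L ^ k * M0 i ≤ P.sitesPerDir 0) {R R₀ R₁ ρ : ℝ} (hR : 0 ≤ R) (hR₁ : 0 ≤ R₁)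
    (hR10 : R₁ < R₀) (hρ : ρ < R) (hgap : ∀ i, ((P.L ^ k * M0 i : ℕ) : ℝ) + R ≤ P.sitesPerDir 0) (hW : 2 * (sg : ℝ) / 3 + R₀ / 2 + R ≤ W)
    {y₁ : Balaban1983to89.Site P (0 + k)}
    (hdeepB : ∀ μ, (c (Fin.cast hPd μ) : ℝ) * P.L ^ k + (R₀ + R) ≤ (P.L : ℝ) ^ k * (y₁ μ).val ∧
      (P.L : ℝ) ^ k * (y₁ μ).val + P.L ^ k + (R₀ + R) ≤ (c (Fin.cast hPd μ) : ℝ) * P.L ^ k + (P.L : ℝ) ^ k * M0 (Fin.cast hPd μ)) :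
    (∀ x ∈ blockK k y₁, x ∈ (univ : Finset (Balaban1983to89.Site P 0))) ∧
    (∀ x ∈ blockK k y₁, ∀ y, cutoff R₁ R₀ (B5Ineq137Torus.T P 0) x y ≠ 0 → ∑ α, lamFam hPd (P.L ^ k) c M0 sg α x y = 1) ∧
    (∀ x ∈ blockK k y₁, ∀ (α : ↥(labels (P.L ^ k) M0 sg)) (y : Balaban1983to89.Site P 0),
      cutoff R₁ R₀ (B5Ineq137Torus.T P 0) x y * lamFam hPd (P.L ^ k) c M0 sg α x y ≠ 0 →
        x ∈ deepRows ρ (cubeFam hPd (P.L ^ k) c M0 sg W α) ∧ y ∈ cubeFam hPd (P.L ^ k) c M0 sg W α ∧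
          ∀ w, w ∉ cubeFam hPd (P.L ^ k) c M0 sg W α → R ≤ B5Ineq137Torus.T P 0 x w ∧ R ≤ B5Ineq137Torus.T P 0 y w) ∧
    (∀ x ∈ blockK k y₁, ∀ y, B5Ineq137Torus.T P 0 x y ≤ R₁ → cutoff R₁ R₀ (B5Ineq137Torus.T P 0) x y = 1) ∧
    ∃ S : Finset ↥(labels (P.L ^ k) M0 sg), S.card ≤ (⌊(((P.L : ℝ) ^ k) - 1 + R₀) / sg⌋₊ + 3) ^ (d + 1) ∧
      ∀ x ∈ blockK k y₁, ∀ (α : ↥(labels (P.L ^ k) M0 sg)) (y : Balaban1983to89.Site P 0),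
        cutoff R₁ R₀ (B5Ineq137Torus.T P 0) x y * lamFam hPd (P.L ^ k) c M0 sg α x y ≠ 0 → α ∈ S := by
  have hR₀ : 0 ≤ R₀ := hR₁.trans hR10.le
  have hζ0 := cutoff_eq_zero_of_le (P := P) hR10
  have hxdeep := fun x (hx : x ∈ blockK k y₁) => mem_and_depth_of_mem_blockK hPd hk hfit0 (by linarith : 0 ≤ R₀ + R) hdeepB hx
  have hxdeep₀ := fun x (hx : x ∈ blockK k y₁) => depth_mono hPd (show R₀ ≤ R₀ + R by linarith) (hxdeep x hx).2
  refine ⟨fun x _ => mem_univ x, fun x hx => rowHyp_i hPd hfit0 hζ0 (hxdeep x hx).1 (hxdeep₀ x hx),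
    fun x hx => rowHyp_ii_deep hPd hn hsg hfit0 hR hR₀ hρ hgap hW hζ0 (hxdeep x hx).1 (hxdeep x hx).2,
    fun x _ => rowHyp_iii hR10 x, ?_⟩
  refine ⟨(activeLabels hPd (P.L ^ k) c sg R₀ y₁).subtype fun α => α ∈ labels (P.L ^ k) M0 sg, ?_, ?_⟩
  · have h1 : ((activeLabels hPd (P.L ^ k) c sg R₀ y₁).subtype fun α => α ∈ labels (P.L ^ k) M0 sg).card ≤
        (activeLabels hPd (P.L ^ k) c sg R₀ y₁).card := by
      rw [Finset.card_subtype]; exact Finset.card_filter_le _ _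
    have h2 := card_activeLabels_le (hPd := hPd) (c := c) (R₀ := R₀) hn hsg hR₀ y₁
    have e1 : (((P.L ^ k : ℕ) : ℕ) : ℝ) = (P.L : ℝ) ^ k := by push_cast; rfl
    rw [e1] at h2
    exact h1.trans h2
  · intro x hx α y hne
    rw [Finset.mem_subtype]
    exact mem_activeLabels_of_ne_zero_of_deep hk hsg hfit0 hζ0 hx (hxdeep₀ x hx) hne

end Rows

/-! ## §3 (2.31) (operator and kernel forms) with `Ω = T_η`, and (2.30), at a small-plaquette background, for the torus data -/

section Members231

variable {d : ℕ}

/-- kernel: `|ζ″| ≤ 1` for p13's cut-off. [folklore] -/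
private theorem abs_cutoff_le_one (R₁ R₀ : ℝ) (x y : Balaban1983to89.Site P 0) : |cutoff R₁ R₀ (B5Ineq137Torus.T P 0) x y| ≤ 1 :=
  abs_le.2 ⟨by linarith [(cutoff_mem_unitInterval R₁ R₀ x y).1], (cutoff_mem_unitInterval R₁ R₀ x y).2⟩

/-- **(2.31), OPERATOR FORM, `Ω = T_η`, AT A GENERAL SMALL-PLAQUETTE NON-FLAT BACKGROUND, FOR THE PRINTED TORUS DATA** (p. 263: *"|(G_{k,loc}(u)f −
G_k(Ω,u)f)(x)| ≦ e^{−cr(e_k)}e^{−c dist(suppt f,x)}‖f‖_∞ (2.31) for dist(x, Ω^c) ≧ O(r(e_k))"*; [I] p. 326 *"under the restriction (7.3.1) on the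
gauge field"*).  For `2 ≤ d′ = d + 1 ≤ 3`, `L = ℓ + 1` odd, `a > 0`: `∃ δ₀, c₀ > 0` (from `(d, ℓ, a)` only) such that on every torus of the series, at every
level `1 ≤ k ≤ K` with `2(L^k − 1) + 4 < |T^{(0)}|`, for every `U(1)` field `u` with `‖u(∂p) − 1‖ ≤ θ`, `0 ≤ θ`, `(L^{2k}θ)² ≤ 1/500` (NO gauge
condition), every reference no-wrap box `Ω₀ = c·L^k + Π_i[0, L^k·M₀_i)` (`M₀_i ≥ 1`, shorter than the torus, torus gap `≥ R`), spacing `s_g ≥ 1`,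
half-width `W ≥ 2s_g/3 + R₀/2 + R`, radii `R > 10L^k`, `0 ≤ R₁ < R₀`, every fine row `x ∈ Ω₀` of chart depth `≥ R₀ + R`, and every `f` with `‖f‖_∞ ≤ F`
supported at sup-torus distance `≥ D ≥ 0` from `x`:
`‖(G_{k,loc}(u)f − G_k(T_η,u)f)(x)‖ ≤ (L^kε)²·c₀·(m·e^{−2δ₀R/L^k} + e^{−(δ₀/2)R₁/L^k})·e^{−(δ₀/2)D/L^k}·F`, `m = (⌊(L^k − 1 + R₀)/s_g⌋ + 3)^{d+1}`, where
`G_{k,loc}(u)` is built from p29's torus cubes `□_α` (2.27), weights `λ_α` and p13's cut-off `ζ″` (2.29) — p31 v1.1's `opClose231_gen` BY NAME with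
`X₀ = T^{(0)}`, `X_α` = the `10L^k`-deep rows of `□_α`, its three inputs from §1. [cite: BalabanImbrieJaffe1988, (2.31) p.263]
[cite: BalabanImbrieJaffe1985, (7.3.1) p.326] -/
theorem opClose231_smallPlaquette_torus_cwt (d ℓ : ℕ) (hd1 : 1 ≤ d) (hd3 : d + 1 ≤ 3) (hℓ : 1 ≤ ℓ) (hodd : Odd (ℓ + 1)) {a : ℝ} (ha : 0 < a) :
    ∃ δ₀ c₀ : ℝ, 0 < δ₀ ∧ 0 < c₀ ∧ ∀ (P : Params) (hPd : P.d = d + 1), P.L = ℓ + 1 →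
      ∀ (k : ℕ), 1 ≤ k → k ≤ P.K → 2 * (P.L ^ k - 1) + 4 < P.sitesPerDir 0 →
      ∀ (U : GaugeField P 0 U1) (θ : ℝ), 0 ≤ θ → (∀ (y : Balaban1983to89.Site P 0) (μ ν : Fin P.d), ‖plaqC U y μ ν - 1‖ ≤ θ) →
        (((P.L : ℝ) ^ k) ^ 2 * θ) ^ 2 ≤ 1 / 500 →
      ∀ (c M0 : Fin (d + 1) → ℕ), (∀ i, 1 ≤ M0 i) → (∀ i, c i * P.L ^ k + P.L ^ k * M0 i ≤ P.sitesPerDir 0) →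
        (∀ i, P.L ^ k * M0 i < P.sitesPerDir 0) →
      ∀ (sg W : ℕ), 1 ≤ sg → ∀ (R R₀ R₁ : ℝ), 10 * (P.L : ℝ) ^ k < R → 0 ≤ R₁ → R₁ < R₀ →
        2 * (sg : ℝ) / 3 + R₀ / 2 + R ≤ W → (∀ i, ((P.L ^ k * M0 i : ℕ) : ℝ) + R ≤ P.sitesPerDir 0) →
      ∀ (x : Balaban1983to89.Site P 0), x ∈ (cubeT hPd (P.L ^ k) c fun i => P.L ^ k * M0 i) →
        (∀ i, R₀ + R ≤ (boxCoord hPd (P.L ^ k) c x i : ℝ) ∧ (boxCoord hPd (P.L ^ k) c x i : ℝ) + (R₀ + R) ≤ (P.L ^ k * M0 i : ℕ) - 1) →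
      ∀ (f : Balaban1983to89.Site P 0 → ℂ) (F D : ℝ), (∀ y, ‖f y‖ ≤ F) → 0 ≤ D → (∀ y, f y ≠ 0 → D ≤ B5Ineq137Torus.T P 0 x y) →
        ‖(gLocT (B1RG242Torus.α P a k * (P.L : ℝ) ^ (k * P.d)) P.eps⁻¹ U k
              (cubeFam hPd (P.L ^ k) c M0 sg W) (lamFam hPd (P.L ^ k) c M0 sg) (cutoff R₁ R₀ (B5Ineq137Torus.T P 0)) *ᵥ f) x -
            (gBox (B1RG242Torus.α P a k * (P.L : ℝ) ^ (k * P.d)) P.eps⁻¹ U k univ *ᵥ f) x‖ ≤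
          P.spacing k ^ 2 * (c₀ * (((⌊(((P.L : ℝ) ^ k) - 1 + R₀) / sg⌋₊ : ℝ) + 3) ^ (d + 1) *
              Real.exp (-(δ₀ * (((P.L : ℝ) ^ k)⁻¹ * (2 * R)))) +
                Real.exp (-(δ₀ / 2 * (((P.L : ℝ) ^ k)⁻¹ * R₁)))) *
            Real.exp (-(δ₀ / 2 * (((P.L : ℝ) ^ k)⁻¹ * D))) * F) := by
  obtain ⟨δ₀, c₀, hδ₀, hc₀, I⟩ := inputs_smallPlaquette d ℓ hd1 hd3 hℓ hodd ha
  refine ⟨δ₀, c₀, hδ₀, hc₀, ?_⟩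
  intro P hPd hPL k hk1 hkK hbig U θ hθ0 hθ hτ c M0 hM0 hfit0 hN0 sg W hsg R R₀ R₁ hRm hR₁ hR10 hW hgap x hx hdeep f F D hF hD hsupp
  obtain ⟨I1, -, I3⟩ := I P hPd hPL hk1 hkK hbig U hθ0 hθ hτ hM0 hfit0 hN0 sg W
  have hkm : k ≤ P.m + P.K := hkK.trans (Nat.le_add_left _ _)
  have hk : 0 + k ≤ P.m + P.K := by omega
  have hn : 1 ≤ P.L ^ k := Nat.one_le_pow _ _ P.L_pos
  have hPk : (0 : ℝ) < (P.L : ℝ) ^ k := pow_pos P.cast_L_pos k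
  have hR : 0 ≤ R := le_trans (by positivity) hRm.le
  have hR₀ : 0 ≤ R₀ := hR₁.trans hR10.le
  have hζ0 := cutoff_eq_zero_of_le (P := P) hR10
  have hF0 : 0 ≤ F := (norm_nonneg _).trans (hF x)
  have hdeep₀ := depth_mono hPd (show R₀ ≤ R₀ + R by linarith) hdeep
  set S : Finset ↥(labels (P.L ^ k) M0 sg) :=
    (activeLabels hPd (P.L ^ k) c sg R₀ (blkIter k x)).subtype fun α => α ∈ labels (P.L ^ k) M0 sg with hSdef
  have hS : ∀ (α : ↥(labels (P.L ^ k) M0 sg)) (y : Balaban1983to89.Site P 0),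
      cutoff R₁ R₀ (B5Ineq137Torus.T P 0) x y * lamFam hPd (P.L ^ k) c M0 sg α x y ≠ 0 → f y ≠ 0 → α ∈ S := by
    intro α y hne _
    rw [hSdef, Finset.mem_subtype]
    exact mem_activeLabels_of_ne_zero_of_deep hk hsg hfit0 hζ0 (mem_blockK.2 rfl) hdeep₀ hne
  have hB := opClose231_gen (B1RG242Torus.α P a k * (P.L : ℝ) ^ (k * P.d)) P.eps⁻¹ U univ univ
    (cubeFam hPd (P.L ^ k) c M0 sg W) (fun α => deepRows (10 * (P.L : ℝ) ^ k) (cubeFam hPd (P.L ^ k) c M0 sg W α))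
    (lam := lamFam hPd (P.L ^ k) c M0 sg) (ζ'' := cutoff R₁ R₀ (B5Ineq137Torus.T P 0))
    (sum_abs_lamT_le_one hfit0) (cutoff_mem_unitInterval R₁ R₀) hδ₀.le hc₀.le I1 I3
    x (mem_univ x) hR (rowHyp_i hPd hfit0 hζ0 hx hdeep₀)
    (rowHyp_ii_deep hPd hn hsg hfit0 hR hR₀ hRm hgap hW hζ0 hx hdeep) (rowHyp_iii hR10 x) f hF hD hsupp S hS
  refine hB.trans ?_
  have hcard : (S.card : ℝ) ≤ (⌊(((P.L : ℝ) ^ k) - 1 + R₀) / sg⌋₊ + 3) ^ (d + 1) := by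
    have h1 := card_subtype_activeLabels_le (hPd := hPd) (c := c) (M0 := M0) hn hsg hR₀ (blkIter k x)
    have e1 : (((P.L ^ k : ℕ) : ℕ) : ℝ) = (P.L : ℝ) ^ k := by push_cast; rfl
    rw [hSdef]
    rw [e1] at h1
    exact h1
  have hE1 := (Real.exp_pos (-(δ₀ * (((P.L : ℝ) ^ k)⁻¹ * (2 * R))))).le
  have hE2 := (Real.exp_pos (-(δ₀ / 2 * (((P.L : ℝ) ^ k)⁻¹ * D)))).le
  refine mul_le_mul_of_nonneg_left ?_ (sq_nonneg _)
  refine mul_le_mul_of_nonneg_right (mul_le_mul_of_nonneg_right (mul_le_mul_of_nonneg_left ?_ hc₀.le) hE2) hF0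
  exact add_le_add (mul_le_mul_of_nonneg_right hcard hE1) le_rfl

/-- **(2.31), KERNEL FORM, `Ω = T_η`, AT A GENERAL SMALL-PLAQUETTE BACKGROUND, FOR THE PRINTED TORUS DATA**: with the data and hypotheses of
`opClose231_smallPlaquette_torus_cwt`, for every fine row `x ∈ Ω₀` of chart depth `≥ R₀ + R` and EVERY `y ∈ T^{(0)}`:
`‖G_{k,loc}(u; x, y) − G_k(T_η, u; x, y)‖ ≤ (L^kε)²·c₀·(e^{−2δ₀R/L^k} + e^{−(δ₀/2)R₁/L^k})·e^{−(δ₀/2)|x−y|_T/L^k}` — p31 v1.1's `close231_kernel_gen` BY NAME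
(convexity absorbs the multiplicity). [cite: BalabanImbrieJaffe1988, (2.31) p.263] -/
theorem close231_smallPlaquette_torus_kernel_cwt (d ℓ : ℕ) (hd1 : 1 ≤ d) (hd3 : d + 1 ≤ 3) (hℓ : 1 ≤ ℓ) (hodd : Odd (ℓ + 1)) {a : ℝ}
    (ha : 0 < a) :
    ∃ δ₀ c₀ : ℝ, 0 < δ₀ ∧ 0 < c₀ ∧ ∀ (P : Params) (hPd : P.d = d + 1), P.L = ℓ + 1 →
      ∀ (k : ℕ), 1 ≤ k → k ≤ P.K → 2 * (P.L ^ k - 1) + 4 < P.sitesPerDir 0 →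
      ∀ (U : GaugeField P 0 U1) (θ : ℝ), 0 ≤ θ → (∀ (y : Balaban1983to89.Site P 0) (μ ν : Fin P.d), ‖plaqC U y μ ν - 1‖ ≤ θ) →
        (((P.L : ℝ) ^ k) ^ 2 * θ) ^ 2 ≤ 1 / 500 →
      ∀ (c M0 : Fin (d + 1) → ℕ), (∀ i, 1 ≤ M0 i) → (∀ i, c i * P.L ^ k + P.L ^ k * M0 i ≤ P.sitesPerDir 0) →
        (∀ i, P.L ^ k * M0 i < P.sitesPerDir 0) →
      ∀ (sg W : ℕ), 1 ≤ sg → ∀ (R R₀ R₁ : ℝ), 10 * (P.L : ℝ) ^ k < R → 0 ≤ R₁ → R₁ < R₀ →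
        2 * (sg : ℝ) / 3 + R₀ / 2 + R ≤ W → (∀ i, ((P.L ^ k * M0 i : ℕ) : ℝ) + R ≤ P.sitesPerDir 0) →
      ∀ (x : Balaban1983to89.Site P 0), x ∈ (cubeT hPd (P.L ^ k) c fun i => P.L ^ k * M0 i) →
        (∀ i, R₀ + R ≤ (boxCoord hPd (P.L ^ k) c x i : ℝ) ∧ (boxCoord hPd (P.L ^ k) c x i : ℝ) + (R₀ + R) ≤ (P.L ^ k * M0 i : ℕ) - 1) →
      ∀ y : Balaban1983to89.Site P 0,
        ‖gLocT (B1RG242Torus.α P a k * (P.L : ℝ) ^ (k * P.d)) P.eps⁻¹ U k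
              (cubeFam hPd (P.L ^ k) c M0 sg W) (lamFam hPd (P.L ^ k) c M0 sg) (cutoff R₁ R₀ (B5Ineq137Torus.T P 0)) x y -
            gBox (B1RG242Torus.α P a k * (P.L : ℝ) ^ (k * P.d)) P.eps⁻¹ U k univ x y‖ ≤
          P.spacing k ^ 2 * (c₀ * (Real.exp (-(δ₀ * (((P.L : ℝ) ^ k)⁻¹ * (2 * R)))) +
              Real.exp (-(δ₀ / 2 * (((P.L : ℝ) ^ k)⁻¹ * R₁)))) *
            Real.exp (-(δ₀ / 2 * (((P.L : ℝ) ^ k)⁻¹ * B5Ineq137Torus.T P 0 x y)))) := by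
  obtain ⟨δ₀, c₀, hδ₀, hc₀, I⟩ := inputs_smallPlaquette d ℓ hd1 hd3 hℓ hodd ha
  refine ⟨δ₀, c₀, hδ₀, hc₀, ?_⟩
  intro P hPd hPL k hk1 hkK hbig U θ hθ0 hθ hτ c M0 hM0 hfit0 hN0 sg W hsg R R₀ R₁ hRm hR₁ hR10 hW hgap x hx hdeep y
  obtain ⟨I1, -, I3⟩ := I P hPd hPL hk1 hkK hbig U hθ0 hθ hτ hM0 hfit0 hN0 sg W
  have hkm : k ≤ P.m + P.K := hkK.trans (Nat.le_add_left _ _)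
  have hk : 0 + k ≤ P.m + P.K := by omega
  have hn : 1 ≤ P.L ^ k := Nat.one_le_pow _ _ P.L_pos
  have hPk : (0 : ℝ) < (P.L : ℝ) ^ k := pow_pos P.cast_L_pos k
  have hR : 0 ≤ R := le_trans (by positivity) hRm.le
  have hR₀ : 0 ≤ R₀ := hR₁.trans hR10.le
  have hζ0 := cutoff_eq_zero_of_le (P := P) hR10
  have hdeep₀ := depth_mono hPd (show R₀ ≤ R₀ + R by linarith) hdeep
  exact close231_kernel_gen (B1RG242Torus.α P a k * (P.L : ℝ) ^ (k * P.d)) P.eps⁻¹ U univ univ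
    (cubeFam hPd (P.L ^ k) c M0 sg W) (fun α => deepRows (10 * (P.L : ℝ) ^ k) (cubeFam hPd (P.L ^ k) c M0 sg W α))
    (lam := lamFam hPd (P.L ^ k) c M0 sg) (ζ'' := cutoff R₁ R₀ (B5Ineq137Torus.T P 0))
    (sum_abs_lamT_le_one hfit0) (cutoff_mem_unitInterval R₁ R₀) hδ₀.le hc₀.le I1 I3
    x (mem_univ x) hR (rowHyp_i hPd hfit0 hζ0 hx hdeep₀)
    (rowHyp_ii_deep hPd hn hsg hfit0 hR hR₀ hRm hgap hW hζ0 hx hdeep) (rowHyp_iii hR10 x) y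

/-- **(2.30), OPERATOR FORM, AT A GENERAL SMALL-PLAQUETTE BACKGROUND, FOR THE PRINTED TORUS DATA** (p. 263: *"|(G_{k,loc}(u)f)(x)| ≦
ce^{−c dist(suppt f,x)}‖f‖_∞, (2.30)"*): with the data and hypotheses of `opClose231_smallPlaquette_torus_cwt`, for every fine row `x ∈ Ω₀` of chart
depth `≥ R₀ + R` and every `f` with `‖f‖_∞ ≤ F` supported at sup-torus distance `≥ D ≥ 0` from `x`: `‖(G_{k,loc}(u)f)(x)‖ ≤ (L^kε)²·m·c₀·e^{−δ₀D/L^k}·F` —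
p31 v1.1's `opDecay230_gen` BY NAME ((H1.10″) for the torus cubes from §1). [cite: BalabanImbrieJaffe1988, (2.30) p.263] -/
theorem opDecay230_smallPlaquette_cwt (d ℓ : ℕ) (hd1 : 1 ≤ d) (hd3 : d + 1 ≤ 3) (hℓ : 1 ≤ ℓ) (hodd : Odd (ℓ + 1)) {a : ℝ} (ha : 0 < a) :
    ∃ δ₀ c₀ : ℝ, 0 < δ₀ ∧ 0 < c₀ ∧ ∀ (P : Params) (hPd : P.d = d + 1), P.L = ℓ + 1 →
      ∀ (k : ℕ), 1 ≤ k → k ≤ P.K → 2 * (P.L ^ k - 1) + 4 < P.sitesPerDir 0 →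
      ∀ (U : GaugeField P 0 U1) (θ : ℝ), 0 ≤ θ → (∀ (y : Balaban1983to89.Site P 0) (μ ν : Fin P.d), ‖plaqC U y μ ν - 1‖ ≤ θ) →
        (((P.L : ℝ) ^ k) ^ 2 * θ) ^ 2 ≤ 1 / 500 →
      ∀ (c M0 : Fin (d + 1) → ℕ), (∀ i, 1 ≤ M0 i) → (∀ i, c i * P.L ^ k + P.L ^ k * M0 i ≤ P.sitesPerDir 0) →
        (∀ i, P.L ^ k * M0 i < P.sitesPerDir 0) →
      ∀ (sg W : ℕ), 1 ≤ sg → ∀ (R R₀ R₁ : ℝ), 10 * (P.L : ℝ) ^ k < R → 0 ≤ R₁ → R₁ < R₀ →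
        2 * (sg : ℝ) / 3 + R₀ / 2 + R ≤ W → (∀ i, ((P.L ^ k * M0 i : ℕ) : ℝ) + R ≤ P.sitesPerDir 0) →
      ∀ (x : Balaban1983to89.Site P 0), x ∈ (cubeT hPd (P.L ^ k) c fun i => P.L ^ k * M0 i) →
        (∀ i, R₀ + R ≤ (boxCoord hPd (P.L ^ k) c x i : ℝ) ∧ (boxCoord hPd (P.L ^ k) c x i : ℝ) + (R₀ + R) ≤ (P.L ^ k * M0 i : ℕ) - 1) →
      ∀ (f : Balaban1983to89.Site P 0 → ℂ) (F D : ℝ), (∀ y, ‖f y‖ ≤ F) → 0 ≤ D → (∀ y, f y ≠ 0 → D ≤ B5Ineq137Torus.T P 0 x y) →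
        ‖(gLocT (B1RG242Torus.α P a k * (P.L : ℝ) ^ (k * P.d)) P.eps⁻¹ U k
              (cubeFam hPd (P.L ^ k) c M0 sg W) (lamFam hPd (P.L ^ k) c M0 sg) (cutoff R₁ R₀ (B5Ineq137Torus.T P 0)) *ᵥ f) x‖ ≤
          P.spacing k ^ 2 * (((⌊(((P.L : ℝ) ^ k) - 1 + R₀) / sg⌋₊ : ℝ) + 3) ^ (d + 1) *
            (c₀ * Real.exp (-(δ₀ * (((P.L : ℝ) ^ k)⁻¹ * D))) * F)) := by
  obtain ⟨δ₀, c₀, hδ₀, hc₀, I⟩ := inputs_smallPlaquette d ℓ hd1 hd3 hℓ hodd ha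
  refine ⟨δ₀, c₀, hδ₀, hc₀, ?_⟩
  intro P hPd hPL k hk1 hkK hbig U θ hθ0 hθ hτ c M0 hM0 hfit0 hN0 sg W hsg R R₀ R₁ hRm hR₁ hR10 hW hgap x hx hdeep f F D hF hD hsupp
  obtain ⟨-, I2, -⟩ := I P hPd hPL hk1 hkK hbig U hθ0 hθ hτ hM0 hfit0 hN0 sg W
  have hkm : k ≤ P.m + P.K := hkK.trans (Nat.le_add_left _ _)
  have hk : 0 + k ≤ P.m + P.K := by omega
  have hn : 1 ≤ P.L ^ k := Nat.one_le_pow _ _ P.L_pos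
  have hPk : (0 : ℝ) < (P.L : ℝ) ^ k := pow_pos P.cast_L_pos k
  have hR : 0 ≤ R := le_trans (by positivity) hRm.le
  have hR₀ : 0 ≤ R₀ := hR₁.trans hR10.le
  have hζ0 := cutoff_eq_zero_of_le (P := P) hR10
  have hF0 : 0 ≤ F := (norm_nonneg _).trans (hF x)
  have hdeep₀ := depth_mono hPd (show R₀ ≤ R₀ + R by linarith) hdeep
  set S : Finset ↥(labels (P.L ^ k) M0 sg) :=
    (activeLabels hPd (P.L ^ k) c sg R₀ (blkIter k x)).subtype fun α => α ∈ labels (P.L ^ k) M0 sg with hSdef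
  have hS : ∀ (α : ↥(labels (P.L ^ k) M0 sg)) (y : Balaban1983to89.Site P 0),
      cutoff R₁ R₀ (B5Ineq137Torus.T P 0) x y * lamFam hPd (P.L ^ k) c M0 sg α x y ≠ 0 → f y ≠ 0 → α ∈ S := by
    intro α y hne _
    rw [hSdef, Finset.mem_subtype]
    exact mem_activeLabels_of_ne_zero_of_deep hk hsg hfit0 hζ0 (mem_blockK.2 rfl) hdeep₀ hne
  have hB := opDecay230_gen (k := k) (B1RG242Torus.α P a k * (P.L : ℝ) ^ (k * P.d)) P.eps⁻¹ U
    (cubeFam hPd (P.L ^ k) c M0 sg W) (fun α => deepRows (10 * (P.L : ℝ) ^ k) (cubeFam hPd (P.L ^ k) c M0 sg W α))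
    (lam := lamFam hPd (P.L ^ k) c M0 sg) (ζ'' := cutoff R₁ R₀ (B5Ineq137Torus.T P 0))
    (sum_abs_lamT_le_one hfit0) (abs_cutoff_le_one R₁ R₀) (δ₀ := δ₀) hc₀.le I2
    x f hF hD hsupp (fun α y hne => (rowHyp_ii_deep hPd hn hsg hfit0 hR hR₀ hRm hgap hW hζ0 hx hdeep α y hne).1) S hS
  refine hB.trans ?_
  have hcard : (S.card : ℝ) ≤ (⌊(((P.L : ℝ) ^ k) - 1 + R₀) / sg⌋₊ + 3) ^ (d + 1) := by
    have h1 := card_subtype_activeLabels_le (hPd := hPd) (c := c) (M0 := M0) hn hsg hR₀ (blkIter k x)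
    have e1 : (((P.L ^ k : ℕ) : ℕ) : ℝ) = (P.L : ℝ) ^ k := by push_cast; rfl
    rw [hSdef]
    rw [e1] at h1
    exact h1
  refine mul_le_mul_of_nonneg_left (mul_le_mul_of_nonneg_right hcard ?_) (sq_nonneg _)
  exact mul_nonneg (mul_nonneg hc₀.le (Real.exp_pos _).le) hF0

end Members231

/-! ## §4 (2.35) with `Ω = T_η` and (2.36) at a small-plaquette background, for the torus data -/

section Members235

variable {d : ℕ}

/-- kernel: `|ζ″| ≤ 1` for p13's cut-off (copy for this section). [folklore] -/
private theorem abs_cutoff_le_one₂ (R₁ R₀ : ℝ) (x y : Balaban1983to89.Site P 0) : |cutoff R₁ R₀ (B5Ineq137Torus.T P 0) x y| ≤ 1 :=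
  abs_le.2 ⟨by linarith [(cutoff_mem_unitInterval R₁ R₀ x y).1], (cutoff_mem_unitInterval R₁ R₀ x y).2⟩

/-- **(2.35), `Ω = T_η`, AT A GENERAL SMALL-PLAQUETTE NON-FLAT BACKGROUND, FOR THE PRINTED TORUS DATA** (p. 263: *"Hence |Δ_{k,loc}(u;x₁,x₂) −
Δ_k(Ω,u;x₁,x₂)| ≦ e^{−cr(e_k)}e^{−c|x₁−x₂|} for dist({x₁,x₂},Ω^c) > O(r(e_k)). (2.35)"*): with the data of `opClose231_smallPlaquette_torus_cwt`, for
every `k`-site `y₁` whose block lies in `Ω₀` with chart margin `R₀ + R` and every `y₂ ∈ T^{(k)}`: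
`‖Δ_{k,loc}(u; y₁, y₂) − Δ_k(T_η,u; y₁, y₂)‖ ≤ A·a_k·c₀e^{δ₀/2}·(m·e^{−2δ₀R/L^k} + e^{−(δ₀/2)R₁/L^k})·e^{−(δ₀/2)|y₁−y₂|_{T^{(k)}}}` (`A = α_kL^{kd′}` the counting
normalization, `Δ_{k,loc} = a_kI − a_k²Q_kG_{k,loc}Q_k^*` on the torus data) — p31 v1.1's `close235_gen` BY NAME, rows from §2.
[cite: BalabanImbrieJaffe1988, (2.35) p.263] -/
theorem close235_smallPlaquette_torus_cwt (d ℓ : ℕ) (hd1 : 1 ≤ d) (hd3 : d + 1 ≤ 3) (hℓ : 1 ≤ ℓ) (hodd : Odd (ℓ + 1)) {a : ℝ} (ha : 0 < a) :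
    ∃ δ₀ c₀ : ℝ, 0 < δ₀ ∧ 0 < c₀ ∧ ∀ (P : Params) (hPd : P.d = d + 1), P.L = ℓ + 1 →
      ∀ (k : ℕ), 1 ≤ k → k ≤ P.K → 2 * (P.L ^ k - 1) + 4 < P.sitesPerDir 0 →
      ∀ (U : GaugeField P 0 U1) (θ : ℝ), 0 ≤ θ → (∀ (y : Balaban1983to89.Site P 0) (μ ν : Fin P.d), ‖plaqC U y μ ν - 1‖ ≤ θ) →
        (((P.L : ℝ) ^ k) ^ 2 * θ) ^ 2 ≤ 1 / 500 →
      ∀ (c M0 : Fin (d + 1) → ℕ), (∀ i, 1 ≤ M0 i) → (∀ i, c i * P.L ^ k + P.L ^ k * M0 i ≤ P.sitesPerDir 0) →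
        (∀ i, P.L ^ k * M0 i < P.sitesPerDir 0) →
      ∀ (sg W : ℕ), 1 ≤ sg → ∀ (R R₀ R₁ : ℝ), 10 * (P.L : ℝ) ^ k < R → 0 ≤ R₁ → R₁ < R₀ →
        2 * (sg : ℝ) / 3 + R₀ / 2 + R ≤ W → (∀ i, ((P.L ^ k * M0 i : ℕ) : ℝ) + R ≤ P.sitesPerDir 0) →
      ∀ (y₁ y₂ : Balaban1983to89.Site P (0 + k)),
        (∀ μ, (c (Fin.cast hPd μ) : ℝ) * P.L ^ k + (R₀ + R) ≤ (P.L : ℝ) ^ k * (y₁ μ).val ∧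
          (P.L : ℝ) ^ k * (y₁ μ).val + P.L ^ k + (R₀ + R) ≤ (c (Fin.cast hPd μ) : ℝ) * P.L ^ k + (P.L : ℝ) ^ k * M0 (Fin.cast hPd μ)) →
        ‖deltaLocT (B1RG242Torus.α P a k * (P.L : ℝ) ^ (k * P.d)) P.eps⁻¹ U k
              (cubeFam hPd (P.L ^ k) c M0 sg W) (lamFam hPd (P.L ^ k) c M0 sg) (cutoff R₁ R₀ (B5Ineq137Torus.T P 0)) y₁ y₂ -
            deltaRegion (B1RG242Torus.α P a k * (P.L : ℝ) ^ (k * P.d)) P.eps⁻¹ U k univ y₁ y₂‖ ≤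
          (B1RG242Torus.α P a k * (P.L : ℝ) ^ (k * P.d)) * (B1.aSeq a P.L k * (c₀ * Real.exp (δ₀ / 2)) *
            (((⌊(((P.L : ℝ) ^ k) - 1 + R₀) / sg⌋₊ : ℝ) + 3) ^ (d + 1) *
              Real.exp (-(δ₀ * (((P.L : ℝ) ^ k)⁻¹ * (2 * R)))) +
                Real.exp (-(δ₀ / 2 * (((P.L : ℝ) ^ k)⁻¹ * R₁)))) *
              Real.exp (-(δ₀ / 2 * B5Ineq137Torus.T P (0 + k) y₁ y₂))) := by
  obtain ⟨δ₀, c₀, hδ₀, hc₀, I⟩ := inputs_smallPlaquette d ℓ hd1 hd3 hℓ hodd ha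
  refine ⟨δ₀, c₀, hδ₀, hc₀, ?_⟩
  intro P hPd hPL k hk1 hkK hbig U θ hθ0 hθ hτ c M0 hM0 hfit0 hN0 sg W hsg R R₀ R₁ hRm hR₁ hR10 hW hgap y₁ y₂ hy₁
  obtain ⟨I1, -, I3⟩ := I P hPd hPL hk1 hkK hbig U hθ0 hθ hτ hM0 hfit0 hN0 sg W
  have hkm : k ≤ P.m + P.K := hkK.trans (Nat.le_add_left _ _)
  have hk : 0 + k ≤ P.m + P.K := by omega
  have hn : 1 ≤ P.L ^ k := Nat.one_le_pow _ _ P.L_pos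
  have hPk : (0 : ℝ) < (P.L : ℝ) ^ k := pow_pos P.cast_L_pos k
  have hR : 0 ≤ R := le_trans (by positivity) hRm.le
  have hR₀ : 0 ≤ R₀ := hR₁.trans hR10.le
  have hζ0 := cutoff_eq_zero_of_le (P := P) hR10
  obtain ⟨hX₀, hcomp, hdeep, hcut, S, hSm, hS⟩ := rows_of_deep hPd hk hn hsg hfit0 hR hR₁ hR10 hRm hgap hW hy₁
  have h := close235_gen hk1 hk ha P.eps⁻¹ U univ univ (cubeFam hPd (P.L ^ k) c M0 sg W)
    (fun α => deepRows (10 * (P.L : ℝ) ^ k) (cubeFam hPd (P.L ^ k) c M0 sg W α))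
    (lam := lamFam hPd (P.L ^ k) c M0 sg) (ζ'' := cutoff R₁ R₀ (B5Ineq137Torus.T P 0))
    (sum_abs_lamT_le_one hfit0) (cutoff_mem_unitInterval R₁ R₀) hδ₀.le hc₀.le I1 I3 hR y₁ y₂ hX₀ hcomp hdeep hcut S hS
  refine h.trans ?_
  have hak0 : 0 < B1.aSeq a P.L k := B1.aSeq_pos ha (B1RG242Torus.one_lt_cast_L P) hk1
  have hα : 0 < B1RG242Torus.α P a k := mul_pos hak0 (inv_pos.mpr (pow_pos (P.spacing_pos k) 2))
  have hA0 : 0 ≤ B1RG242Torus.α P a k * (P.L : ℝ) ^ (k * P.d) := (mul_pos hα (pow_pos P.cast_L_pos _)).le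
  have hSm' : (S.card : ℝ) ≤ (⌊(((P.L : ℝ) ^ k) - 1 + R₀) / sg⌋₊ + 3) ^ (d + 1) := by exact_mod_cast hSm
  have hE1 := (Real.exp_pos (-(δ₀ * (((P.L : ℝ) ^ k)⁻¹ * (2 * R))))).le
  refine mul_le_mul_of_nonneg_left ?_ hA0
  refine mul_le_mul_of_nonneg_right (mul_le_mul_of_nonneg_left ?_ (by positivity)) (Real.exp_pos _).le
  exact add_le_add (mul_le_mul_of_nonneg_right hSm' hE1) le_rfl

/-- **(2.36) FOR `Δ_{k,loc}(u)` AT A GENERAL SMALL-PLAQUETTE NON-FLAT BACKGROUND, FOR THE PRINTED TORUS DATA** (p. 263: *"|Δ_{k,loc}(u; x₁, x₂)| ≦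
ce^{−|x₁−x₂|}, (2.36)"*): with the data of `opClose231_smallPlaquette_torus_cwt`, for every `k`-site `y₁` whose block lies in `Ω₀` with chart margin
`R₀ + R` and every `y₂`: `‖Δ_{k,loc}(u; y₁, y₂)‖ ≤ A·(δ_{y₁y₂} + m·a_k·c₀e^{δ₀}·e^{−δ₀|y₁−y₂|_{T^{(k)}}})` — p31 v1.1's `decay236_gen` BY NAME ((H1.10″) for the
torus cubes from §1, row activity from §2). [cite: BalabanImbrieJaffe1988, (2.36) p.263] -/
theorem decay236_smallPlaquette_cwt (d ℓ : ℕ) (hd1 : 1 ≤ d) (hd3 : d + 1 ≤ 3) (hℓ : 1 ≤ ℓ) (hodd : Odd (ℓ + 1)) {a : ℝ} (ha : 0 < a) :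
    ∃ δ₀ c₀ : ℝ, 0 < δ₀ ∧ 0 < c₀ ∧ ∀ (P : Params) (hPd : P.d = d + 1), P.L = ℓ + 1 →
      ∀ (k : ℕ), 1 ≤ k → k ≤ P.K → 2 * (P.L ^ k - 1) + 4 < P.sitesPerDir 0 →
      ∀ (U : GaugeField P 0 U1) (θ : ℝ), 0 ≤ θ → (∀ (y : Balaban1983to89.Site P 0) (μ ν : Fin P.d), ‖plaqC U y μ ν - 1‖ ≤ θ) →
        (((P.L : ℝ) ^ k) ^ 2 * θ) ^ 2 ≤ 1 / 500 →
      ∀ (c M0 : Fin (d + 1) → ℕ), (∀ i, 1 ≤ M0 i) → (∀ i, c i * P.L ^ k + P.L ^ k * M0 i ≤ P.sitesPerDir 0) →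
        (∀ i, P.L ^ k * M0 i < P.sitesPerDir 0) →
      ∀ (sg W : ℕ), 1 ≤ sg → ∀ (R R₀ R₁ : ℝ), 10 * (P.L : ℝ) ^ k < R → 0 ≤ R₁ → R₁ < R₀ →
        2 * (sg : ℝ) / 3 + R₀ / 2 + R ≤ W → (∀ i, ((P.L ^ k * M0 i : ℕ) : ℝ) + R ≤ P.sitesPerDir 0) →
      ∀ (y₁ y₂ : Balaban1983to89.Site P (0 + k)),
        (∀ μ, (c (Fin.cast hPd μ) : ℝ) * P.L ^ k + (R₀ + R) ≤ (P.L : ℝ) ^ k * (y₁ μ).val ∧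
          (P.L : ℝ) ^ k * (y₁ μ).val + P.L ^ k + (R₀ + R) ≤ (c (Fin.cast hPd μ) : ℝ) * P.L ^ k + (P.L : ℝ) ^ k * M0 (Fin.cast hPd μ)) →
        ‖deltaLocT (B1RG242Torus.α P a k * (P.L : ℝ) ^ (k * P.d)) P.eps⁻¹ U k
              (cubeFam hPd (P.L ^ k) c M0 sg W) (lamFam hPd (P.L ^ k) c M0 sg) (cutoff R₁ R₀ (B5Ineq137Torus.T P 0)) y₁ y₂‖ ≤
          (B1RG242Torus.α P a k * (P.L : ℝ) ^ (k * P.d)) *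
            ((if y₁ = y₂ then 1 else 0) +
              ((⌊(((P.L : ℝ) ^ k) - 1 + R₀) / sg⌋₊ : ℝ) + 3) ^ (d + 1) * B1.aSeq a P.L k * (c₀ * Real.exp δ₀) *
                Real.exp (-(δ₀ * B5Ineq137Torus.T P (0 + k) y₁ y₂))) := by
  obtain ⟨δ₀, c₀, hδ₀, hc₀, I⟩ := inputs_smallPlaquette d ℓ hd1 hd3 hℓ hodd ha
  refine ⟨δ₀, c₀, hδ₀, hc₀, ?_⟩
  intro P hPd hPL k hk1 hkK hbig U θ hθ0 hθ hτ c M0 hM0 hfit0 hN0 sg W hsg R R₀ R₁ hRm hR₁ hR10 hW hgap y₁ y₂ hy₁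
  obtain ⟨-, I2, -⟩ := I P hPd hPL hk1 hkK hbig U hθ0 hθ hτ hM0 hfit0 hN0 sg W
  have hkm : k ≤ P.m + P.K := hkK.trans (Nat.le_add_left _ _)
  have hk : 0 + k ≤ P.m + P.K := by omega
  have hn : 1 ≤ P.L ^ k := Nat.one_le_pow _ _ P.L_pos
  have hPk : (0 : ℝ) < (P.L : ℝ) ^ k := pow_pos P.cast_L_pos k
  have hR : 0 ≤ R := le_trans (by positivity) hRm.le
  have hR₀ : 0 ≤ R₀ := hR₁.trans hR10.le
  have hζ0 := cutoff_eq_zero_of_le (P := P) hR10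
  obtain ⟨-, -, hdeep, -, S, hSm, hS⟩ := rows_of_deep hPd hk hn hsg hfit0 hR hR₁ hR10 hRm hgap hW hy₁
  have h := decay236_gen hk1 hk ha P.eps⁻¹ U (cubeFam hPd (P.L ^ k) c M0 sg W)
    (fun α => deepRows (10 * (P.L : ℝ) ^ k) (cubeFam hPd (P.L ^ k) c M0 sg W α))
    (lam := lamFam hPd (P.L ^ k) c M0 sg) (ζ'' := cutoff R₁ R₀ (B5Ineq137Torus.T P 0))
    (sum_abs_lamT_le_one hfit0) (abs_cutoff_le_one₂ R₁ R₀) hδ₀.le hc₀.le I2 y₁ y₂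
    (fun x hx α y hne => (hdeep x hx α y hne).1) S hS
  refine h.trans ?_
  have hak0 : 0 < B1.aSeq a P.L k := B1.aSeq_pos ha (B1RG242Torus.one_lt_cast_L P) hk1
  have hα : 0 < B1RG242Torus.α P a k := mul_pos hak0 (inv_pos.mpr (pow_pos (P.spacing_pos k) 2))
  have hA0 : 0 ≤ B1RG242Torus.α P a k * (P.L : ℝ) ^ (k * P.d) := (mul_pos hα (pow_pos P.cast_L_pos _)).le
  have hSm' : (S.card : ℝ) ≤ (⌊(((P.L : ℝ) ^ k) - 1 + R₀) / sg⌋₊ + 3) ^ (d + 1) := by exact_mod_cast hSm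
  refine mul_le_mul_of_nonneg_left (add_le_add le_rfl ?_) hA0
  exact mul_le_mul_of_nonneg_right (mul_le_mul_of_nonneg_right (mul_le_mul_of_nonneg_right hSm' hak0.le) (by positivity))
    (Real.exp_pos _).le

end Members235

/-! ## §5 (2.38) for `Δ_{k,loc}(u)` at a small-plaquette background, for the torus data -/

section Member238

variable {d : ℕ}

/-- **(2.38) FOR `Δ_{k,loc}(u)`, `Ω = T_η`, AT A GENERAL SMALL-PLAQUETTE NON-FLAT BACKGROUND, FOR THE PRINTED TORUS DATA** (p. 264: *"Finally, in view
of (2.35), the lower bound (I.7.3.2) applies to Δ_{k,loc}(u) as well. Let φ be supported in a region having an r(e_k) neighborhood where u is smooth.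
Then ⟨φ, Δ_{k,loc}(u)φ⟩ ≧ c₁Σ_b|u(b)φ(b₊) − φ(b₋)|² − ce_k²p(e_k)²Σ_x|φ(x)|². (2.38)"*).  With the data of `opClose231_smallPlaquette_torus_cwt`, for every set
`Λ` of `k`-sites whose blocks lie in `Ω₀` with chart margin `R₀ + R` and every `φ` supported in `Λ`:
`(A/a_k)·[γ₀·Σ_b‖u_k(b)φ(b₊) − φ(b₋)‖² − ((4/3)d′⁴(L^{2k}θ)² + a_k²·c₀e^{δ₀/2}K_{d′}(δ₀/2)·(m·e^{−2δ₀R/L^k} + e^{−(δ₀/2)R₁/L^k}))·Σ_y‖φ(y)‖²] ≤ Re⟨φ, Δ_{k,loc}(u)φ⟩`,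
`γ₀ = min(a/(9(d′+1)), 1/12)`, `u_k = lineIter u k` — p31 v1.1's `ineq238_gen` BY NAME (its (7.3.2) input gen 20's `ineq238_deltaRegion_smallField_region`
at `Ω = T`; inputs §1; rows §2). [cite: BalabanImbrieJaffe1988, (2.38) p.264] [cite: BalabanImbrieJaffe1985, (7.3.2) p.326] -/
theorem ineq238_smallPlaquette_torus_cwt (d ℓ : ℕ) (hd1 : 1 ≤ d) (hd3 : d + 1 ≤ 3) (hℓ : 1 ≤ ℓ) (hodd : Odd (ℓ + 1)) {a : ℝ} (ha : 0 < a) :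
    ∃ δ₀ c₀ : ℝ, 0 < δ₀ ∧ 0 < c₀ ∧ ∀ (P : Params) (hPd : P.d = d + 1), P.L = ℓ + 1 →
      ∀ (k : ℕ), 1 ≤ k → k ≤ P.K → 2 * (P.L ^ k - 1) + 4 < P.sitesPerDir 0 →
      ∀ (U : GaugeField P 0 U1) (θ : ℝ), 0 ≤ θ → (∀ (y : Balaban1983to89.Site P 0) (μ ν : Fin P.d), ‖plaqC U y μ ν - 1‖ ≤ θ) →
        (((P.L : ℝ) ^ k) ^ 2 * θ) ^ 2 ≤ 1 / 500 →
      ∀ (c M0 : Fin (d + 1) → ℕ), (∀ i, 1 ≤ M0 i) → (∀ i, c i * P.L ^ k + P.L ^ k * M0 i ≤ P.sitesPerDir 0) →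
        (∀ i, P.L ^ k * M0 i < P.sitesPerDir 0) →
      ∀ (sg W : ℕ), 1 ≤ sg → ∀ (R R₀ R₁ : ℝ), 10 * (P.L : ℝ) ^ k < R → 0 ≤ R₁ → R₁ < R₀ →
        2 * (sg : ℝ) / 3 + R₀ / 2 + R ≤ W → (∀ i, ((P.L ^ k * M0 i : ℕ) : ℝ) + R ≤ P.sitesPerDir 0) →
      ∀ (Λ : Finset (Balaban1983to89.Site P (0 + k))),
        (∀ y₁ ∈ Λ, ∀ μ, (c (Fin.cast hPd μ) : ℝ) * P.L ^ k + (R₀ + R) ≤ (P.L : ℝ) ^ k * (y₁ μ).val ∧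
          (P.L : ℝ) ^ k * (y₁ μ).val + P.L ^ k + (R₀ + R) ≤ (c (Fin.cast hPd μ) : ℝ) * P.L ^ k + (P.L : ℝ) ^ k * M0 (Fin.cast hPd μ)) →
      ∀ (φ : Balaban1983to89.Site P (0 + k) → ℂ), (∀ y ∉ Λ, φ y = 0) →
        (B1RG242Torus.α P a k * (P.L : ℝ) ^ (k * P.d)) / B1.aSeq a P.L k *
            (min (a / (9 * (P.d + 1))) (1 / 12) * ∑ b : PBond P (0 + k), ‖toC (lineIter U k b) * φ b.tgt - φ b.src‖ ^ 2
              - (4 / 3 * (P.d : ℝ) ^ 4 * (((P.L : ℝ) ^ k) ^ 2 * θ) ^ 2 +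
            B1.aSeq a P.L k ^ 2 * (c₀ * Real.exp (δ₀ / 2) * latticeConst P.d (δ₀ / 2)) *
              (((⌊(((P.L : ℝ) ^ k) - 1 + R₀) / sg⌋₊ : ℝ) + 3) ^ (d + 1) *
                  Real.exp (-(δ₀ * (((P.L : ℝ) ^ k)⁻¹ * (2 * R)))) +
                Real.exp (-(δ₀ / 2 * (((P.L : ℝ) ^ k)⁻¹ * R₁))))) *
                ∑ y : Balaban1983to89.Site P (0 + k), ‖φ y‖ ^ 2)
          ≤ (star φ ⬝ᵥ (deltaLocT (B1RG242Torus.α P a k * (P.L : ℝ) ^ (k * P.d)) P.eps⁻¹ U k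
              (cubeFam hPd (P.L ^ k) c M0 sg W) (lamFam hPd (P.L ^ k) c M0 sg) (cutoff R₁ R₀ (B5Ineq137Torus.T P 0)) *ᵥ φ)).re := by
  obtain ⟨δ₀, c₀, hδ₀, hc₀, I⟩ := inputs_smallPlaquette d ℓ hd1 hd3 hℓ hodd ha
  refine ⟨δ₀, c₀, hδ₀, hc₀, ?_⟩
  intro P hPd hPL k hk1 hkK hbig U θ hθ0 hθ hτ c M0 hM0 hfit0 hN0 sg W hsg R R₀ R₁ hRm hR₁ hR10 hW hgap Λ hΛ φ hφ
  obtain ⟨I1, -, I3⟩ := I P hPd hPL hk1 hkK hbig U hθ0 hθ hτ hM0 hfit0 hN0 sg W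
  have hkm : k ≤ P.m + P.K := hkK.trans (Nat.le_add_left _ _)
  have hk : 0 + k ≤ P.m + P.K := by omega
  have hn : 1 ≤ P.L ^ k := Nat.one_le_pow _ _ P.L_pos
  have hPk : (0 : ℝ) < (P.L : ℝ) ^ k := pow_pos P.cast_L_pos k
  have hR : 0 ≤ R := le_trans (by positivity) hRm.le
  have hR₀ : 0 ≤ R₀ := hR₁.trans hR10.le
  have hζ0 := cutoff_eq_zero_of_le (P := P) hR10
  have h := ineq238_gen hk1 hk ha U hθ (isBlockUnion_univ k) univ (cubeFam hPd (P.L ^ k) c M0 sg W)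
    (fun α => deepRows (10 * (P.L : ℝ) ^ k) (cubeFam hPd (P.L ^ k) c M0 sg W α))
    (lam := lamFam hPd (P.L ^ k) c M0 sg) (ζ'' := cutoff R₁ R₀ (B5Ineq137Torus.T P 0))
    (sum_abs_lamT_le_one hfit0) (cutoff_mem_unitInterval R₁ R₀) hδ₀ hc₀.le I1 I3
    hR ((⌊(((P.L : ℝ) ^ k) - 1 + R₀) / sg⌋₊ + 3) ^ (d + 1)) (fun ψ => ∀ y ∉ Λ, ψ y = 0)
    (fun ψ hψ y₁ hy₁ => rows_of_deep hPd hk hn hsg hfit0 hR hR₁ hR10 hRm hgap hW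
      (hΛ y₁ (by by_contra h'; exact hy₁ (hψ y₁ h'))))
    (fun ψ _ b _ => by rw [starB_innerK_univ]; exact mem_univ _) φ hφ
  refine le_trans (le_of_eq ?_) h
  push_cast
  ring

end Member238

/-! ## §6 (2.40) and (4.9)_{j≥1} for `Δ_{k,loc}(u)` at a small-plaquette background, for the torus data -/

section Member240

variable {d : ℕ}

/-- **(2.40) AND (4.9)_{j≥1} FOR `Δ_{k,loc}(u)`, `Ω = T_η`, AT A GENERAL SMALL-PLAQUETTE NON-FLAT BACKGROUND, FOR THE PRINTED TORUS DATA** (p. 264: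
*"We define C^{(k)}_Λ(u) = [(Δ_{k,loc}(u) + aL^{−2}Q(u_k)^*Q(u_k))|_Λ]^{−1}. (2.40) This is of course a nonlocal operator, but by (2.38), C^{(k)}_Λ(u)^{−1}
is bounded below"*; p. 275 (4.9): the Gaussian normalization `Z^{(j)}_Λ`, `j ≥ 1`).  With the data of `ineq238_smallPlaquette_torus_cwt` and `k + 1 ≤ m + K`,
for every `Λ` of `k`-sites whose blocks lie in `Ω₀` with chart margin `R₀ + R`, every smallness `(T₁, δ′, σ)` of the averaged field `u_k = lineIter u k`
inside the `L`-blocks of `T^{(k)}` (`‖u_k(b) − 1‖ ≤ T₁` on intra-block bonds, `‖u_k(Γ_{yx}) − 1‖ ≤ δ′`, `2(L−1)L·d′·T₁² + 2δ′² ≤ σ` — [I] (4.5.4) shape),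
every `κ′ ≥ 0` and the largeness condition `E := (4/3)d′⁴(L^{2k}θ)² + a_k²c₀e^{δ₀/2}K_{d′}(δ₀/2)(m·e^{−2δ₀R/L^k} + e^{−(δ₀/2)R₁/L^k}) < c240(γ₀, κ′)·(1 − σ)`
(print's *"by (2.38) … bounded below"*, located: radii `≫ L^k`, `θ ≪ L^{−2k}`), for all `E_s, N`: the realified precision matrix
`realify((Δ_{k,loc}(u) + (A/a_k)κ′P(u_k))|_Λ)` IS POSITIVE DEFINITE, `Z^{(k)}_Λ = e^{−E_sN}(2π)^{#(Λ×2)/2}/√det(…)` and `Z^{(k)}_Λ > 0` — p31 v1.1's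
`Z49_gen` BY NAME (symmetry of the data: gen 21's `lamFam_symm`/`cutoff_T_symm`; cubes are `k`-block unions via p29's `cubeFam_fits`).
[cite: BalabanImbrieJaffe1988, (2.40) p.264] [cite: BalabanImbrieJaffe1988, (4.9) p.275] -/
theorem Z49_smallPlaquette_torus_cwt (d ℓ : ℕ) (hd1 : 1 ≤ d) (hd3 : d + 1 ≤ 3) (hℓ : 1 ≤ ℓ) (hodd : Odd (ℓ + 1)) {a : ℝ} (ha : 0 < a) :
    ∃ δ₀ c₀ : ℝ, 0 < δ₀ ∧ 0 < c₀ ∧ ∀ (P : Params) (hPd : P.d = d + 1), P.L = ℓ + 1 →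
      ∀ (k : ℕ), 1 ≤ k → k ≤ P.K → k + 1 ≤ P.m + P.K → 2 * (P.L ^ k - 1) + 4 < P.sitesPerDir 0 →
      ∀ (U : GaugeField P 0 U1) (θ : ℝ), 0 ≤ θ → (∀ (y : Balaban1983to89.Site P 0) (μ ν : Fin P.d), ‖plaqC U y μ ν - 1‖ ≤ θ) →
        (((P.L : ℝ) ^ k) ^ 2 * θ) ^ 2 ≤ 1 / 500 →
      ∀ (c M0 : Fin (d + 1) → ℕ), (∀ i, 1 ≤ M0 i) → (∀ i, c i * P.L ^ k + P.L ^ k * M0 i ≤ P.sitesPerDir 0) →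
        (∀ i, P.L ^ k * M0 i < P.sitesPerDir 0) →
      ∀ (sg W : ℕ), 1 ≤ sg → ∀ (R R₀ R₁ : ℝ), 10 * (P.L : ℝ) ^ k < R → 0 ≤ R₁ → R₁ < R₀ →
        2 * (sg : ℝ) / 3 + R₀ / 2 + R ≤ W → (∀ i, ((P.L ^ k * M0 i : ℕ) : ℝ) + R ≤ P.sitesPerDir 0) →
      ∀ (Λ : Finset (Balaban1983to89.Site P (0 + k))),
        (∀ y₁ ∈ Λ, ∀ μ, (c (Fin.cast hPd μ) : ℝ) * P.L ^ k + (R₀ + R) ≤ (P.L : ℝ) ^ k * (y₁ μ).val ∧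
          (P.L : ℝ) ^ k * (y₁ μ).val + P.L ^ k + (R₀ + R) ≤ (c (Fin.cast hPd μ) : ℝ) * P.L ^ k + (P.L : ℝ) ^ k * M0 (Fin.cast hPd μ)) →
      ∀ (T₁ δ' σ : ℝ),
        (∀ b : PBond P (0 + k), blkIter 1 b.src = blkIter 1 b.tgt → ‖toC (lineIter U k b) - 1‖ ≤ T₁) →
        (∀ y : Balaban1983to89.Site P (0 + k), ‖holCK (lineIter U k) 1 y - 1‖ ≤ δ') →
        2 * (((P.L : ℝ) - 1) * P.L) * P.d * T₁ ^ 2 + 2 * δ' ^ 2 ≤ σ →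
      ∀ (κ' : ℝ), 0 ≤ κ' →
        4 / 3 * (P.d : ℝ) ^ 4 * (((P.L : ℝ) ^ k) ^ 2 * θ) ^ 2 +
            B1.aSeq a P.L k ^ 2 * (c₀ * Real.exp (δ₀ / 2) * latticeConst P.d (δ₀ / 2)) *
              (((⌊(((P.L : ℝ) ^ k) - 1 + R₀) / sg⌋₊ : ℝ) + 3) ^ (d + 1) *
                  Real.exp (-(δ₀ * (((P.L : ℝ) ^ k)⁻¹ * (2 * R)))) +
                Real.exp (-(δ₀ / 2 * (((P.L : ℝ) ^ k)⁻¹ * R₁)))) <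
          c240 P (min (a / (9 * (P.d + 1))) (1 / 12)) κ' * (1 - σ) →
      ∀ (Es N : ℝ),
        (realify (compress Λ (op240 (deltaLocT (B1RG242Torus.α P a k * (P.L : ℝ) ^ (k * P.d)) P.eps⁻¹ U k (cubeFam hPd (P.L ^ k) c M0 sg W)
            (lamFam hPd (P.L ^ k) c M0 sg) (cutoff R₁ R₀ (B5Ineq137Torus.T P 0)))
            ((B1RG242Torus.α P a k * (P.L : ℝ) ^ (k * P.d)) / B1.aSeq a P.L k * κ') (lineIter U k)))).PosDef ∧
        Z49 (realify (compress Λ (op240 (deltaLocT (B1RG242Torus.α P a k * (P.L : ℝ) ^ (k * P.d)) P.eps⁻¹ U k (cubeFam hPd (P.L ^ k) c M0 sg W)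
            (lamFam hPd (P.L ^ k) c M0 sg) (cutoff R₁ R₀ (B5Ineq137Torus.T P 0)))
            ((B1RG242Torus.α P a k * (P.L : ℝ) ^ (k * P.d)) / B1.aSeq a P.L k * κ') (lineIter U k)))) Es N =
          Real.exp (-(Es * N)) * (Real.sqrt (2 * Real.pi) ^ Fintype.card (↥Λ × Fin 2) /
            Real.sqrt (realify (compress Λ (op240 (deltaLocT (B1RG242Torus.α P a k * (P.L : ℝ) ^ (k * P.d)) P.eps⁻¹ U k (cubeFam hPd (P.L ^ k) c M0 sg W)
            (lamFam hPd (P.L ^ k) c M0 sg) (cutoff R₁ R₀ (B5Ineq137Torus.T P 0)))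
            ((B1RG242Torus.α P a k * (P.L : ℝ) ^ (k * P.d)) / B1.aSeq a P.L k * κ') (lineIter U k)))).det) ∧
        0 < Z49 (realify (compress Λ (op240 (deltaLocT (B1RG242Torus.α P a k * (P.L : ℝ) ^ (k * P.d)) P.eps⁻¹ U k (cubeFam hPd (P.L ^ k) c M0 sg W)
            (lamFam hPd (P.L ^ k) c M0 sg) (cutoff R₁ R₀ (B5Ineq137Torus.T P 0)))
            ((B1RG242Torus.α P a k * (P.L : ℝ) ^ (k * P.d)) / B1.aSeq a P.L k * κ') (lineIter U k)))) Es N := by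
  obtain ⟨δ₀, c₀, hδ₀, hc₀, I⟩ := inputs_smallPlaquette d ℓ hd1 hd3 hℓ hodd ha
  refine ⟨δ₀, c₀, hδ₀, hc₀, ?_⟩
  intro P hPd hPL k hk1 hkK hk' hbig U θ hθ0 hθ hτ c M0 hM0 hfit0 hN0 sg W hsg R R₀ R₁ hRm hR₁ hR10 hW hgap Λ hΛ T₁ δ' σ hInt hTree hσ κ' hκ' hE Es N
  obtain ⟨I1, -, I3⟩ := I P hPd hPL hk1 hkK hbig U hθ0 hθ hτ hM0 hfit0 hN0 sg W
  have hkm : k ≤ P.m + P.K := hkK.trans (Nat.le_add_left _ _)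
  have hk : 0 + k ≤ P.m + P.K := by omega
  have hn : 1 ≤ P.L ^ k := Nat.one_le_pow _ _ P.L_pos
  have hPk : (0 : ℝ) < (P.L : ℝ) ^ k := pow_pos P.cast_L_pos k
  have hR : 0 ≤ R := le_trans (by positivity) hRm.le
  have hR₀ : 0 ≤ R₀ := hR₁.trans hR10.le
  have hζ0 := cutoff_eq_zero_of_le (P := P) hR10
  have hk'' : 0 + k + 1 ≤ P.m + P.K := by omega
  have hcubeBU : ∀ α : ↥(labels (P.L ^ k) M0 sg), IsBlockUnion k (cubeFam hPd (P.L ^ k) c M0 sg W α) := fun α => by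
    obtain ⟨c', M, hM, hfit', -, e⟩ := cubeFam_fits (hPd := hPd) (s := sg) (W := W) hM0 hfit0 hN0 α
    rw [e]; exact isBlockUnion_cubeT hPd hkm rfl hfit'
  have h := Z49_gen hk1 hk'' ha U hθ (isBlockUnion_univ k) univ
    (cube := cubeFam hPd (P.L ^ k) c M0 sg W) hcubeBU
    (fun α => deepRows (10 * (P.L : ℝ) ^ k) (cubeFam hPd (P.L ^ k) c M0 sg W α))
    (lam := lamFam hPd (P.L ^ k) c M0 sg) (ζ'' := cutoff R₁ R₀ (B5Ineq137Torus.T P 0))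
    (sum_abs_lamT_le_one hfit0) (fun α x₁ x₂ => lamFam_symm hPd (P.L ^ k) c M0 sg α x₁ x₂) (cutoff_mem_unitInterval R₁ R₀)
    (cutoff_T_symm R₁ R₀) hδ₀ hc₀.le I1 I3
    hR ((⌊(((P.L : ℝ) ^ k) - 1 + R₀) / sg⌋₊ + 3) ^ (d + 1)) Λ
    (fun y₁ hy₁ => rows_of_deep hPd hk hn hsg hfit0 hR hR₁ hR10 hRm hgap hW (hΛ y₁ hy₁))
    (fun b _ => by rw [starB_innerK_univ]; exact mem_univ _) hInt hTree hσ hκ' (by push_cast at hE ⊢; exact hE) Es N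
  exact h

end Member240

/-! ## §7 (2.41) for `C^{(k)}_Λ(u)` at a small-plaquette background, for the torus data -/

section Member241

variable {d : ℕ}

/-- **(2.41) FOR `C^{(k)}_Λ(u) = [(Δ_{k,loc}(u) + (A/a_k)κ′P(u_k))|_Λ]^{−1}`, `Ω = T_η`, AT A GENERAL SMALL-PLAQUETTE NON-FLAT BACKGROUND, FOR THE PRINTED
TORUS DATA** (p. 264: *"a random walk expansion as in [6] can be used to prove that |C^{(k)}_Λ(u; x₁, x₂)| ≦ ce^{−c|x₁−x₂|}. (2.41)"*).  With the data and
hypotheses of `Z49_smallPlaquette_torus_cwt` (`E < c240(γ₀,κ′)(1−σ)`) and a decay rate `0 ≤ ϑ ≤ δ₀/4` with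
`ϑ·(4/δ₀)(2K_{d′}(δ₀/2))·(a_k(1 + m·a_kc₀e^{δ₀}) + κ′L^{−2d′}e^{δ₀(L−1)}) ≤ (c240(γ₀,κ′)(1−σ) − E)/2`:
**`‖C^{(k)}_Λ(u; x₁, x₂)‖ ≤ (A/a_k)^{−1}·(4/(c240(γ₀,κ′)(1−σ) − E))·e^{−ϑ|x₁−x₂|_{T^{(k)}}}`** for all `x₁, x₂ ∈ Λ` — p31 v1.1's `decay241_gen` BY NAME,
uniformly in the torus and `Λ`. [cite: BalabanImbrieJaffe1988, (2.41) p.264] -/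
theorem decay241_smallPlaquette_torus_cwt (d ℓ : ℕ) (hd1 : 1 ≤ d) (hd3 : d + 1 ≤ 3) (hℓ : 1 ≤ ℓ) (hodd : Odd (ℓ + 1)) {a : ℝ} (ha : 0 < a) :
    ∃ δ₀ c₀ : ℝ, 0 < δ₀ ∧ 0 < c₀ ∧ ∀ (P : Params) (hPd : P.d = d + 1), P.L = ℓ + 1 →
      ∀ (k : ℕ), 1 ≤ k → k ≤ P.K → k + 1 ≤ P.m + P.K → 2 * (P.L ^ k - 1) + 4 < P.sitesPerDir 0 →
      ∀ (U : GaugeField P 0 U1) (θ : ℝ), 0 ≤ θ → (∀ (y : Balaban1983to89.Site P 0) (μ ν : Fin P.d), ‖plaqC U y μ ν - 1‖ ≤ θ) →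
        (((P.L : ℝ) ^ k) ^ 2 * θ) ^ 2 ≤ 1 / 500 →
      ∀ (c M0 : Fin (d + 1) → ℕ), (∀ i, 1 ≤ M0 i) → (∀ i, c i * P.L ^ k + P.L ^ k * M0 i ≤ P.sitesPerDir 0) →
        (∀ i, P.L ^ k * M0 i < P.sitesPerDir 0) →
      ∀ (sg W : ℕ), 1 ≤ sg → ∀ (R R₀ R₁ : ℝ), 10 * (P.L : ℝ) ^ k < R → 0 ≤ R₁ → R₁ < R₀ →
        2 * (sg : ℝ) / 3 + R₀ / 2 + R ≤ W → (∀ i, ((P.L ^ k * M0 i : ℕ) : ℝ) + R ≤ P.sitesPerDir 0) →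
      ∀ (Λ : Finset (Balaban1983to89.Site P (0 + k))),
        (∀ y₁ ∈ Λ, ∀ μ, (c (Fin.cast hPd μ) : ℝ) * P.L ^ k + (R₀ + R) ≤ (P.L : ℝ) ^ k * (y₁ μ).val ∧
          (P.L : ℝ) ^ k * (y₁ μ).val + P.L ^ k + (R₀ + R) ≤ (c (Fin.cast hPd μ) : ℝ) * P.L ^ k + (P.L : ℝ) ^ k * M0 (Fin.cast hPd μ)) →
      ∀ (T₁ δ' σ : ℝ),
        (∀ b : PBond P (0 + k), blkIter 1 b.src = blkIter 1 b.tgt → ‖toC (lineIter U k b) - 1‖ ≤ T₁) →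
        (∀ y : Balaban1983to89.Site P (0 + k), ‖holCK (lineIter U k) 1 y - 1‖ ≤ δ') →
        2 * (((P.L : ℝ) - 1) * P.L) * P.d * T₁ ^ 2 + 2 * δ' ^ 2 ≤ σ →
      ∀ (κ' : ℝ), 0 ≤ κ' →
        4 / 3 * (P.d : ℝ) ^ 4 * (((P.L : ℝ) ^ k) ^ 2 * θ) ^ 2 +
            B1.aSeq a P.L k ^ 2 * (c₀ * Real.exp (δ₀ / 2) * latticeConst P.d (δ₀ / 2)) *
              (((⌊(((P.L : ℝ) ^ k) - 1 + R₀) / sg⌋₊ : ℝ) + 3) ^ (d + 1) *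
                  Real.exp (-(δ₀ * (((P.L : ℝ) ^ k)⁻¹ * (2 * R)))) +
                Real.exp (-(δ₀ / 2 * (((P.L : ℝ) ^ k)⁻¹ * R₁)))) <
          c240 P (min (a / (9 * (P.d + 1))) (1 / 12)) κ' * (1 - σ) →
      ∀ (ϑ : ℝ), 0 ≤ ϑ → ϑ ≤ δ₀ / 4 →
        ϑ * ((4 / δ₀) * (2 * latticeConst P.d (δ₀ / 2)) *
            (B1.aSeq a P.L k * (1 + ((⌊(((P.L : ℝ) ^ k) - 1 + R₀) / sg⌋₊ : ℝ) + 3) ^ (d + 1) * B1.aSeq a P.L k *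
                (c₀ * Real.exp δ₀)) +
              κ' * (((P.L : ℝ) ^ P.d)⁻¹) ^ 2 * Real.exp (δ₀ * ((P.L : ℝ) - 1)))) ≤
          (c240 P (min (a / (9 * (P.d + 1))) (1 / 12)) κ' * (1 - σ) -
            (4 / 3 * (P.d : ℝ) ^ 4 * (((P.L : ℝ) ^ k) ^ 2 * θ) ^ 2 +
            B1.aSeq a P.L k ^ 2 * (c₀ * Real.exp (δ₀ / 2) * latticeConst P.d (δ₀ / 2)) *
              (((⌊(((P.L : ℝ) ^ k) - 1 + R₀) / sg⌋₊ : ℝ) + 3) ^ (d + 1) *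
                  Real.exp (-(δ₀ * (((P.L : ℝ) ^ k)⁻¹ * (2 * R)))) +
                Real.exp (-(δ₀ / 2 * (((P.L : ℝ) ^ k)⁻¹ * R₁)))))) / 2 →
      ∀ (x₁ x₂ : ↥Λ),
        ‖(compress Λ (op240 (deltaLocT (B1RG242Torus.α P a k * (P.L : ℝ) ^ (k * P.d)) P.eps⁻¹ U k (cubeFam hPd (P.L ^ k) c M0 sg W)
            (lamFam hPd (P.L ^ k) c M0 sg) (cutoff R₁ R₀ (B5Ineq137Torus.T P 0)))
            ((B1RG242Torus.α P a k * (P.L : ℝ) ^ (k * P.d)) / B1.aSeq a P.L k * κ') (lineIter U k)))⁻¹ x₁ x₂‖ ≤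
          ((B1RG242Torus.α P a k * (P.L : ℝ) ^ (k * P.d)) / B1.aSeq a P.L k)⁻¹ *
            (4 / (c240 P (min (a / (9 * (P.d + 1))) (1 / 12)) κ' * (1 - σ) -
              (4 / 3 * (P.d : ℝ) ^ 4 * (((P.L : ℝ) ^ k) ^ 2 * θ) ^ 2 +
            B1.aSeq a P.L k ^ 2 * (c₀ * Real.exp (δ₀ / 2) * latticeConst P.d (δ₀ / 2)) *
              (((⌊(((P.L : ℝ) ^ k) - 1 + R₀) / sg⌋₊ : ℝ) + 3) ^ (d + 1) *
                  Real.exp (-(δ₀ * (((P.L : ℝ) ^ k)⁻¹ * (2 * R)))) +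
                Real.exp (-(δ₀ / 2 * (((P.L : ℝ) ^ k)⁻¹ * R₁))))))) *
            Real.exp (-(ϑ * B5Ineq137Torus.T P (0 + k) x₁ x₂)) := by
  obtain ⟨δ₀, c₀, hδ₀, hc₀, I⟩ := inputs_smallPlaquette d ℓ hd1 hd3 hℓ hodd ha
  refine ⟨δ₀, c₀, hδ₀, hc₀, ?_⟩
  intro P hPd hPL k hk1 hkK hk' hbig U θ hθ0 hθ hτ c M0 hM0 hfit0 hN0 sg W hsg R R₀ R₁ hRm hR₁ hR10 hW hgap Λ hΛ T₁ δ' σ hInt hTree hσ κ' hκ' hE ϑ hϑ0 hϑ hsmall x₁ x₂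
  obtain ⟨I1, I2, I3⟩ := I P hPd hPL hk1 hkK hbig U hθ0 hθ hτ hM0 hfit0 hN0 sg W
  have hkm : k ≤ P.m + P.K := hkK.trans (Nat.le_add_left _ _)
  have hk : 0 + k ≤ P.m + P.K := by omega
  have hn : 1 ≤ P.L ^ k := Nat.one_le_pow _ _ P.L_pos
  have hPk : (0 : ℝ) < (P.L : ℝ) ^ k := pow_pos P.cast_L_pos k
  have hR : 0 ≤ R := le_trans (by positivity) hRm.le
  have hR₀ : 0 ≤ R₀ := hR₁.trans hR10.le
  have hζ0 := cutoff_eq_zero_of_le (P := P) hR10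
  have hk'' : 0 + k + 1 ≤ P.m + P.K := by omega
  have h := decay241_gen hk1 hk'' ha U hθ (isBlockUnion_univ k) univ
    (cubeFam hPd (P.L ^ k) c M0 sg W) (fun α => deepRows (10 * (P.L : ℝ) ^ k) (cubeFam hPd (P.L ^ k) c M0 sg W α))
    (lam := lamFam hPd (P.L ^ k) c M0 sg) (ζ'' := cutoff R₁ R₀ (B5Ineq137Torus.T P 0))
    (sum_abs_lamT_le_one hfit0) (cutoff_mem_unitInterval R₁ R₀) hδ₀ hc₀.le I1 I2 I3
    hR ((⌊(((P.L : ℝ) ^ k) - 1 + R₀) / sg⌋₊ + 3) ^ (d + 1)) Λ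
    (fun y₁ hy₁ => rows_of_deep hPd hk hn hsg hfit0 hR hR₁ hR10 hRm hgap hW (hΛ y₁ hy₁))
    (fun b _ => by rw [starB_innerK_univ]; exact mem_univ _) hInt hTree hσ hκ' (by push_cast at hE ⊢; exact hE) hϑ0 hϑ
    (by push_cast at hsmall ⊢; exact hsmall) x₁ x₂
  push_cast at h ⊢
  exact h

end Member241

end

end Literature.MathematicalPhysics.QuantumFieldTheory.BalabanImbrieJaffe1984to88.BIJ88DeltaLocSmallPlaquetteTorusCwt
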